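import Literature.NumberTheory.LFunctions.DiscreteMomentsR
import Literature.NumberTheory.LFunctions.SmallGCDThirdMoment
import Literature.NumberTheory.LFunctions.LargeValuesS2Bound
import Mathlib.NumberTheory.Harmonic.Bounds
import Mathlib.Analysis.PSeries
import HarnessLib

/-!
# The energy bound: Guth–Maynard Lemma 11.9 and Proposition 11.1

Topic `NumberTheory/LFunctions`, family RH. `LargeValuesAssembly.lean` and `LargeValuesS2Bound.lean`
reduce the tree's named fact `Literature.NumberTheory.LFunctions.zeroDensity_guth_maynard`
(L. Guth, J. Maynard, *New large value estimates for Dirichlet polynomials*, Ann. of Math. 203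
(2026), Theorem 1.2) to Propositions 10.1 and 11.1 of the paper
(`GuthMaynardS2.zeroDensity_guth_maynard_of_S3_of_energy`, hypotheses `hS3`, `hE`). This file PROVES
**Proposition 11.1 ("Bound for energy")** in exactly the form `hE` required there
(`GuthMaynardEnergyBound.energy_bound`), and hence reduces the named fact to Proposition 10.1 alone
(`GuthMaynardEnergyBound.zeroDensity_guth_maynard_of_S3`). All the analytic inputs of §11 of the
paper are already PROVED in the tree and are only assembled here, following the printed proof:

* Lemma 11.4 (`GuthMaynardEnergy.energy_le_third_moment_abs`, `EnergyThirdMoment.lean`):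
  `E(W) ≤ C N^{-2σ} ∑_{n₁,n₂∈[N,2N]} |R(n₁/n₂)|³`;
* Lemmas 11.5, 11.6 (`GuthMaynardDiscreteMoments.discrete_second_moment`,
  `GuthMaynardDiscreteMoments.discrete_fourth_moment`, `DiscreteMomentsR.lean`, from the tree's
  Heath-Brown theorem `HeathBrownDZS.heathBrown_differenceSet`);
* Lemma 11.8 (`GuthMaynardSmallGCD.small_gcd_third_moment`, `SmallGCDThirdMoment.lean`): the terms
  with `gcd(n₁,n₂) ≤ D`.

What is proved here:

* §1 counting: `|W|² ≤ E(W) ≤ 3|W|³` (`card_sq_le_energy`, `energy_le_three_mul_card_cube`);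
* §2 the partition of `[N,2N]²` by the gcd (`sum_sq_eq_sum_gcd`) and, for `gcd = d`, the injection
  `(n₁,n₂) ↦ (n₁/d, n₂/d)` into `[M, 2M]²`, `M = ⌈N/d⌉` (`sum_gcdPairs_le_square`), the sums
  `∑_{D<d≤2N} M_d ≤ 2N(1 + log 2N)`, `∑_{D<d≤2N} M_d² ≤ 4N²/D` (`sum_ceil_div_le`,
  `sum_ceil_div_sq_le`, the former via Mathlib's `harmonic_le_one_add_log`) and two Cauchy–Schwarz inequalities (`sum_cube_le`, `sum_rpow_half_mul_le`);
* §3 **Lemma 11.9 ("Large GCD terms")** in the form preceding the case analysis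
  (`large_gcd_third_moment`: `∑_{gcd>D} |R|³ ≤ C T^η (1+log 2N) A^{1/2} B^{1/2}` with
  `A = |W|²N + |W|N²/D + |W|^{5/4}T^{1/2}N`, `B = |W|⁴N + (N²/D)E + E^{3/4}|W|T^{1/2}N`), and the
  paper's case analysis `|W| ≷ T^{2/3}` as a pure inequality between real numbers for `T = N^{6/5}`
  (`large_gcd_algebra`:
  `(A₀B₀)^{1/2} ≤ 5|W|³N + 2|W|^{21/8}T^{1/4}N + 4E^{1/2}|W|^{1/2}N²`);
* §4 **Proposition 11.1** for `T = N^{6/5}` (`energy_bound`): for `σ ∈ [7/10, 4/5]`, `δ > 0`, all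
  `N ≥ N₀`, `1`-bounded `a_n`, finite `1`-separated `W` in an interval of length `N^{6/5}` with
  `|∑_{N≤n≤2N} a_n n^{it}| ≥ N^σ` on `W`:
  `E(W) ≤ C N^δ (|W|N^{4−4σ} + |W|^{21/8}T^{1/4}N^{1−2σ} + |W|³N^{1−2σ})`
  (the choice `D = ⌈N²/T⌉`, the rearrangement `E ≤ X + Y E^{1/2} ⇒ E ≤ 2X + Y²`);
* §5 `zeroDensity_guth_maynard_of_S3`: the named fact from Proposition 10.1 (`hS3`) alone.

No definition and no named fact is introduced; everything in this file is proved.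

## References

* L. Guth, J. Maynard, *New large value estimates for Dirichlet polynomials*, Ann. of Math. (2)
  203 (2026), no. 2; arXiv:2405.20552 (2024): §11 (Proposition 11.1, Lemmas 11.4–11.9, eqs.
  (11.22)–(11.27)), §12, Theorem 1.2. [key `GuthMaynard2026`]
* D. R. Heath-Brown, *A large values estimate for Dirichlet polynomials*, J. London Math. Soc. (2)
  20 (1979), 8–18 (via `DoubleZetaSumsHeathBrown.lean`).
-/

noncomputable section

open Real Set Filter Topology Complex MeasureTheory Finset
open scoped FourierTransform ContDiff

namespace Literature.NumberTheory.LFunctions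

namespace GuthMaynardEnergyBound

open GuthMaynardRFunction GuthMaynardEnergy GuthMaynardDiscreteMoments GuthMaynardSmallGCD
  GuthMaynardAssembly

/-! ## §1. Counting: `|W|² ≤ E(W) ≤ 3|W|³` -/

/-- The diagonal quadruples `(t₁,t₂,t₁,t₂)` show `|W|² ≤ E(W)`. [cite: GuthMaynard2026, Section 11] -/
theorem card_sq_le_energy (W : Finset ℝ) :
    (W.card : ℝ) ^ 2 ≤ ((((W ×ˢ W) ×ˢ (W ×ˢ W)).filter
      (fun q : (ℝ × ℝ) × (ℝ × ℝ) ↦ |q.1.1 + q.1.2 - q.2.1 - q.2.2| ≤ 1)).card : ℝ) := by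
  classical
  have h : ((W ×ˢ W).image (fun p : ℝ × ℝ ↦ (p, p))).card ≤ (((W ×ˢ W) ×ˢ (W ×ˢ W)).filter
      (fun q : (ℝ × ℝ) × (ℝ × ℝ) ↦ |q.1.1 + q.1.2 - q.2.1 - q.2.2| ≤ 1)).card := by
    refine Finset.card_le_card fun q hq ↦ ?_
    rw [Finset.mem_image] at hq
    obtain ⟨p, hp, rfl⟩ := hq
    rw [Finset.mem_filter]
    refine ⟨Finset.mem_product.mpr ⟨hp, hp⟩, ?_⟩
    show |p.1 + p.2 - p.1 - p.2| ≤ 1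
    rw [show p.1 + p.2 - p.1 - p.2 = 0 by ring, abs_zero]
    exact zero_le_one
  have hinj : Function.Injective (fun p : ℝ × ℝ ↦ (p, p)) := fun p p' h ↦ (Prod.ext_iff.mp h).1
  rw [Finset.card_image_of_injective _ hinj, Finset.card_product] at h
  have : W.card ^ 2 ≤ (((W ×ˢ W) ×ˢ (W ×ˢ W)).filter
      (fun q : (ℝ × ℝ) × (ℝ × ℝ) ↦ |q.1.1 + q.1.2 - q.2.1 - q.2.2| ≤ 1)).card := by
    rw [sq]; exact h
  exact_mod_cast this

/-- For `1`-separated `W`, given `t₁,t₂,t₃` at most three `t₄ ∈ W` satisfy `|t₁+t₂−t₃−t₄| ≤ 1`,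
so `E(W) ≤ 3|W|³`. [cite: GuthMaynard2026, proof of Lemma 11.4] -/
theorem energy_le_three_mul_card_cube (W : Finset ℝ)
    (hsep : ∀ t ∈ W, ∀ t' ∈ W, t ≠ t' → 1 ≤ |t - t'|) :
    ((((W ×ˢ W) ×ˢ (W ×ˢ W)).filter
      (fun q : (ℝ × ℝ) × (ℝ × ℝ) ↦ |q.1.1 + q.1.2 - q.2.1 - q.2.2| ≤ 1)).card : ℝ) ≤
      3 * (W.card : ℝ) ^ 3 := by
  classical
  rw [Finset.card_filter]
  push_cast
  rw [Finset.sum_product, Finset.sum_product]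
  have h : ∀ t₁ t₂ : ℝ, ∑ x ∈ W ×ˢ W,
      (if |t₁ + t₂ - x.1 - x.2| ≤ 1 then (1 : ℝ) else 0) ≤ 3 * W.card := by
    intro t₁ t₂
    rw [Finset.sum_product]
    have h3 : ∀ t₃ ∈ W, ∑ t₄ ∈ W, (if |t₁ + t₂ - t₃ - t₄| ≤ 1 then (1 : ℝ) else 0) ≤ 3 := by
      intro t₃ _
      rw [← Finset.sum_filter, Finset.sum_const, nsmul_eq_mul, mul_one]
      exact card_near_le_three W hsep (t₁ + t₂ - t₃)
    calc ∑ t₃ ∈ W, ∑ t₄ ∈ W, (if |t₁ + t₂ - t₃ - t₄| ≤ 1 then (1 : ℝ) else 0)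
        ≤ ∑ t₃ ∈ W, (3 : ℝ) := Finset.sum_le_sum h3
      _ = 3 * W.card := by rw [Finset.sum_const, nsmul_eq_mul, mul_comm]
  calc ∑ t₁ ∈ W, ∑ t₂ ∈ W, ∑ x ∈ W ×ˢ W, (if |t₁ + t₂ - x.1 - x.2| ≤ 1 then (1 : ℝ) else 0)
      ≤ ∑ t₁ ∈ W, ∑ t₂ ∈ W, (3 * (W.card : ℝ)) :=
        Finset.sum_le_sum fun t₁ _ ↦ Finset.sum_le_sum fun t₂ _ ↦ h t₁ t₂
    _ = 3 * (W.card : ℝ) ^ 3 := by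
        rw [Finset.sum_const, Finset.sum_const, nsmul_eq_mul, nsmul_eq_mul]; ring

/-! ## §2. The partition by the gcd, the reduced squares, sums over `d`, Cauchy–Schwarz -/

/-- **Partition of `[N,2N]²` by the gcd**: for `N ≥ 1`,
`∑_{n₁,n₂∈[N,2N]} g(n₁,n₂) = ∑_{d=1}^{2N} ∑_{gcd(n₁,n₂)=d} g(n₁,n₂)`. [cite: GuthMaynard2026, (11.22)] -/
theorem sum_sq_eq_sum_gcd {N : ℕ} (hN : 1 ≤ N) (g : ℕ → ℕ → ℝ) :
    ∑ n₁ ∈ Finset.Icc N (2 * N), ∑ n₂ ∈ Finset.Icc N (2 * N), g n₁ n₂ =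
      ∑ d ∈ Finset.Icc 1 (2 * N), ∑ p ∈ gcdPairs N d, g p.1 p.2 := by
  classical
  have h1 : ∑ n₁ ∈ Finset.Icc N (2 * N), ∑ n₂ ∈ Finset.Icc N (2 * N), g n₁ n₂ =
      ∑ p ∈ Finset.Icc N (2 * N) ×ˢ Finset.Icc N (2 * N), g p.1 p.2 :=
    (Finset.sum_product' _ _ g).symm
  have hmaps : ∀ p ∈ Finset.Icc N (2 * N) ×ˢ Finset.Icc N (2 * N),
      Nat.gcd p.1 p.2 ∈ Finset.Icc 1 (2 * N) := by
    intro p hp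
    rw [Finset.mem_product, Finset.mem_Icc, Finset.mem_Icc] at hp
    rw [Finset.mem_Icc]
    exact ⟨Nat.pos_of_ne_zero (Nat.gcd_ne_zero_left (by omega)),
      (Nat.gcd_le_left _ (by omega)).trans hp.1.2⟩
  rw [h1]
  exact (Finset.sum_fiberwise_of_maps_to hmaps _).symm

/-- If `d ∣ n`, `d ≥ 1` and `N ≤ n ≤ 2N` then `n/d ∈ [M, 2M]` with `M = ⌈N/d⌉`. [folklore] -/
theorem div_mem_Icc {N d n : ℕ} (hd : 1 ≤ d) (hdn : d ∣ n) (h1 : N ≤ n) (h2 : n ≤ 2 * N) :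
    n / d ∈ Finset.Icc ⌈(N : ℝ) / d⌉₊ (2 * ⌈(N : ℝ) / d⌉₊) := by
  obtain ⟨a, rfl⟩ := hdn
  rw [Nat.mul_div_cancel_left _ (by omega), Finset.mem_Icc]
  have hd0 : (0 : ℝ) < d := by exact_mod_cast (show 0 < d by omega)
  constructor
  · refine Nat.ceil_le.mpr ?_
    rw [div_le_iff₀ hd0]
    calc (N : ℝ) ≤ ((d * a : ℕ) : ℝ) := by exact_mod_cast h1
      _ = (a : ℝ) * d := by push_cast; ring
  · have h3 : (a : ℝ) * d ≤ 2 * N := by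
      calc (a : ℝ) * d = ((d * a : ℕ) : ℝ) := by push_cast; ring
        _ ≤ ((2 * N : ℕ) : ℝ) := by exact_mod_cast h2
        _ = 2 * N := by push_cast; ring
    have h4 : (a : ℝ) ≤ 2 * ((N : ℝ) / d) := by
      rw [mul_div_assoc', le_div_iff₀ hd0]; exact h3
    have h5 : (a : ℝ) ≤ 2 * (⌈(N : ℝ) / d⌉₊ : ℝ) :=
      h4.trans (mul_le_mul_of_nonneg_left (Nat.le_ceil _) zero_le_two)
    exact_mod_cast h5

/-- **The injection `(n₁,n₂) ↦ (n₁/d, n₂/d)`**: for `N, d ≥ 1` and any exponent `k`,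
`∑_{(n₁,n₂)∈[N,2N]², gcd=d} |R(n₁/n₂)|^k ≤ ∑_{m₁,m₂∈[M,2M]} |R(m₁/m₂)|^k` with `M = ⌈N/d⌉`
("we let `d = gcd(n₁,n₂)` and `n₁ = n₁'d`, `n₂ = n₂'d` for some `n₁',n₂' ∼ N/d`", dropping the
coprimality constraint). [cite: GuthMaynard2026, proof of Lemma 11.9] -/
theorem sum_gcdPairs_le_square (W : Finset ℝ) {N d : ℕ} (hN : 1 ≤ N) (hd : 1 ≤ d) (k : ℕ) :
    ∑ p ∈ gcdPairs N d, ‖Rfun W ((p.1 : ℝ) / p.2)‖ ^ k ≤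
      ∑ m₁ ∈ Finset.Icc ⌈(N : ℝ) / d⌉₊ (2 * ⌈(N : ℝ) / d⌉₊),
        ∑ m₂ ∈ Finset.Icc ⌈(N : ℝ) / d⌉₊ (2 * ⌈(N : ℝ) / d⌉₊), ‖Rfun W ((m₁ : ℝ) / m₂)‖ ^ k := by
  classical
  set M := ⌈(N : ℝ) / d⌉₊ with hM
  set φ : ℕ × ℕ → ℕ × ℕ := fun p ↦ (p.1 / d, p.2 / d) with hφ
  set g : ℕ × ℕ → ℝ := fun q ↦ ‖Rfun W ((q.1 : ℝ) / q.2)‖ ^ k with hg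
  have hfg : ∀ p ∈ gcdPairs N d, ‖Rfun W ((p.1 : ℝ) / p.2)‖ ^ k = g (φ p) := by
    intro p hp
    obtain ⟨-, -, -, -, -, hx, -⟩ := gcdPairs_facts hN hp
    simp only [hg, hφ, hx]
  have hdvd : ∀ p ∈ gcdPairs N d, d ∣ p.1 ∧ d ∣ p.2 := by
    intro p hp
    have hgcd := (mem_gcdPairs.mp hp).2.2
    exact ⟨hgcd ▸ Nat.gcd_dvd_left _ _, hgcd ▸ Nat.gcd_dvd_right _ _⟩
  have hinj : Set.InjOn φ (gcdPairs N d) := by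
    intro p hp p' hp' h
    simp only [hφ, Prod.mk.injEq] at h
    obtain ⟨h1, h2⟩ := h
    obtain ⟨hd1, hd2⟩ := hdvd p hp
    obtain ⟨hd1', hd2'⟩ := hdvd p' hp'
    ext
    · calc p.1 = d * (p.1 / d) := (Nat.mul_div_cancel' hd1).symm
        _ = d * (p'.1 / d) := by rw [h1]
        _ = p'.1 := Nat.mul_div_cancel' hd1'
    · calc p.2 = d * (p.2 / d) := (Nat.mul_div_cancel' hd2).symm
        _ = d * (p'.2 / d) := by rw [h2]
        _ = p'.2 := Nat.mul_div_cancel' hd2'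
  have himage : (gcdPairs N d).image φ ⊆ Finset.Icc M (2 * M) ×ˢ Finset.Icc M (2 * M) := by
    intro q hq
    rw [Finset.mem_image] at hq
    obtain ⟨p, hp, rfl⟩ := hq
    obtain ⟨hd1, hd2⟩ := hdvd p hp
    obtain ⟨⟨h11, h12⟩, ⟨h21, h22⟩, -⟩ := mem_gcdPairs.mp hp
    rw [Finset.mem_product]
    exact ⟨div_mem_Icc hd hd1 h11 h12, div_mem_Icc hd hd2 h21 h22⟩
  calc ∑ p ∈ gcdPairs N d, ‖Rfun W ((p.1 : ℝ) / p.2)‖ ^ k = ∑ p ∈ gcdPairs N d, g (φ p) :=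
        Finset.sum_congr rfl hfg
    _ = ∑ q ∈ (gcdPairs N d).image φ, g q := (Finset.sum_image hinj).symm
    _ ≤ ∑ q ∈ Finset.Icc M (2 * M) ×ˢ Finset.Icc M (2 * M), g q :=
        Finset.sum_le_sum_of_subset_of_nonneg himage fun q _ _ ↦ by positivity
    _ = _ := by rw [Finset.sum_product]

/-- `⌈N/d⌉ ≥ 1` for `N, d ≥ 1`. [folklore] -/
theorem one_le_ceil_div {N d : ℕ} (hN : 1 ≤ N) (hd : 1 ≤ d) : 1 ≤ ⌈(N : ℝ) / d⌉₊ := by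
  have : (0 : ℝ) < (N : ℝ) / d := by
    have h1 : (0 : ℝ) < N := by exact_mod_cast hN
    have h2 : (0 : ℝ) < d := by exact_mod_cast hd
    positivity
  exact Nat.ceil_pos.mpr this

/-- `⌈N/d⌉ ≤ 2N/d` for `1 ≤ d ≤ 2N`. [folklore] -/
theorem ceil_div_le {N d : ℕ} (hd : 1 ≤ d) (hd2 : d ≤ 2 * N) :
    (⌈(N : ℝ) / d⌉₊ : ℝ) ≤ 2 * N / d := by
  have hd0 : (0 : ℝ) < d := by exact_mod_cast (show 0 < d by omega)
  rcases le_or_gt d N with hdN | hdN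
  · have h1 : (⌈(N : ℝ) / d⌉₊ : ℝ) < (N : ℝ) / d + 1 := Nat.ceil_lt_add_one (by positivity)
    have h2 : (1 : ℝ) ≤ (N : ℝ) / d := by
      rw [le_div_iff₀ hd0, one_mul]; exact_mod_cast hdN
    have h3 : (N : ℝ) / d + (N : ℝ) / d = 2 * N / d := by ring
    linarith
  · have h1 : (N : ℝ) / d ≤ 1 := by
      rw [div_le_iff₀ hd0, one_mul]; exact_mod_cast hdN.le
    have h2 : ⌈(N : ℝ) / d⌉₊ ≤ 1 := Nat.ceil_le.mpr (by exact_mod_cast h1)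
    have h3 : (⌈(N : ℝ) / d⌉₊ : ℝ) ≤ 1 := by exact_mod_cast h2
    have h4 : (1 : ℝ) ≤ 2 * N / d := by
      rw [le_div_iff₀ hd0, one_mul]; exact_mod_cast hd2
    linarith

/-- `∑_{D<d≤2N} ⌈N/d⌉ ≤ 2N(1 + log 2N)`. [cite: GuthMaynard2026, proof of Lemma 11.9] -/
theorem sum_ceil_div_le (N D : ℕ) :
    ∑ d ∈ Finset.Ioc D (2 * N), (⌈(N : ℝ) / d⌉₊ : ℝ) ≤ 2 * N * (1 + Real.log ((2 * N : ℕ) : ℝ)) := by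
  have h1 : ∑ d ∈ Finset.Ioc D (2 * N), (⌈(N : ℝ) / d⌉₊ : ℝ) ≤
      ∑ d ∈ Finset.Ioc D (2 * N), 2 * (N : ℝ) / d := by
    refine Finset.sum_le_sum fun d hd ↦ ?_
    rw [Finset.mem_Ioc] at hd
    exact ceil_div_le (by omega) hd.2
  have h2 : ∑ d ∈ Finset.Ioc D (2 * N), 2 * (N : ℝ) / d ≤ ∑ d ∈ Finset.Icc 1 (2 * N), 2 * (N : ℝ) / d := by
    refine Finset.sum_le_sum_of_subset_of_nonneg (fun d hd ↦ ?_) fun d _ _ ↦ by positivity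
    rw [Finset.mem_Ioc] at hd
    rw [Finset.mem_Icc]; omega
  have h3 : ∑ d ∈ Finset.Icc 1 (2 * N), 2 * (N : ℝ) / d = 2 * N * ∑ d ∈ Finset.Icc 1 (2 * N), (d : ℝ)⁻¹ := by
    rw [Finset.mul_sum]
    exact Finset.sum_congr rfl fun d _ ↦ by rw [div_eq_mul_inv]
  have h4 : ∑ d ∈ Finset.Icc 1 (2 * N), (d : ℝ)⁻¹ ≤ 1 + Real.log ((2 * N : ℕ) : ℝ) := by
    -- Mathlib's bound for the harmonic numbers (also `SelbergMollifier.sum_Icc_inv_le_log`)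
    have h := harmonic_le_one_add_log (2 * N)
    simp_rw [harmonic_eq_sum_Icc, Rat.cast_sum, Rat.cast_inv, Rat.cast_natCast] at h
    exact h
  calc ∑ d ∈ Finset.Ioc D (2 * N), (⌈(N : ℝ) / d⌉₊ : ℝ)
      ≤ 2 * N * ∑ d ∈ Finset.Icc 1 (2 * N), (d : ℝ)⁻¹ := by rw [← h3]; exact h1.trans h2
    _ ≤ 2 * N * (1 + Real.log ((2 * N : ℕ) : ℝ)) :=
        mul_le_mul_of_nonneg_left h4 (by positivity)

/-- `∑_{D<d≤2N} ⌈N/d⌉² ≤ 4N²/D` for `D ≥ 1` (`∑_{d>D} d^{-2} ≤ 1/D`).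
[cite: GuthMaynard2026, proof of Lemma 11.9] -/
theorem sum_ceil_div_sq_le (N : ℕ) {D : ℕ} (hD : 1 ≤ D) :
    ∑ d ∈ Finset.Ioc D (2 * N), (⌈(N : ℝ) / d⌉₊ : ℝ) ^ 2 ≤ 4 * (N : ℝ) ^ 2 / D := by
  have hD0 : (0 : ℝ) < D := by exact_mod_cast hD
  rcases le_or_gt D (2 * N) with hDN | hDN
  · have h1 : ∑ d ∈ Finset.Ioc D (2 * N), (⌈(N : ℝ) / d⌉₊ : ℝ) ^ 2 ≤
        ∑ d ∈ Finset.Ioc D (2 * N), 4 * (N : ℝ) ^ 2 * ((d : ℝ) ^ 2)⁻¹ := by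
      refine Finset.sum_le_sum fun d hd ↦ ?_
      rw [Finset.mem_Ioc] at hd
      have hd0 : (0 : ℝ) < d := by exact_mod_cast (show 0 < d by omega)
      have h := ceil_div_le (N := N) (d := d) (by omega) hd.2
      calc (⌈(N : ℝ) / d⌉₊ : ℝ) ^ 2 ≤ (2 * N / d) ^ 2 := pow_le_pow_left₀ (Nat.cast_nonneg _) h 2
        _ = 4 * (N : ℝ) ^ 2 * ((d : ℝ) ^ 2)⁻¹ := by field_simp; ring
    have h2 : ∑ d ∈ Finset.Ioc D (2 * N), ((d : ℝ) ^ 2)⁻¹ ≤ (D : ℝ)⁻¹ - ((2 * N : ℕ) : ℝ)⁻¹ :=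
      sum_Ioc_inv_sq_le_sub (by omega) hDN
    have h3 : (D : ℝ)⁻¹ - ((2 * N : ℕ) : ℝ)⁻¹ ≤ (D : ℝ)⁻¹ := by
      have : (0 : ℝ) ≤ ((2 * N : ℕ) : ℝ)⁻¹ := by positivity
      linarith
    calc ∑ d ∈ Finset.Ioc D (2 * N), (⌈(N : ℝ) / d⌉₊ : ℝ) ^ 2
        ≤ 4 * (N : ℝ) ^ 2 * ∑ d ∈ Finset.Ioc D (2 * N), ((d : ℝ) ^ 2)⁻¹ := by
          rw [Finset.mul_sum]; exact h1
      _ ≤ 4 * (N : ℝ) ^ 2 * (D : ℝ)⁻¹ := mul_le_mul_of_nonneg_left (h2.trans h3) (by positivity)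
      _ = 4 * (N : ℝ) ^ 2 / D := by rw [div_eq_mul_inv]
  · rw [Finset.Ioc_eq_empty (by omega), Finset.sum_empty]
    positivity

/-- Cauchy–Schwarz: `∑ a³ ≤ (∑ a²)^{1/2} (∑ a⁴)^{1/2}` for `a ≥ 0`. [folklore] -/
theorem sum_cube_le {ι : Type*} (s : Finset ι) (a : ι → ℝ) (ha : ∀ i ∈ s, 0 ≤ a i) :
    ∑ i ∈ s, a i ^ 3 ≤ (∑ i ∈ s, a i ^ 2) ^ (1 / 2 : ℝ) * (∑ i ∈ s, a i ^ 4) ^ (1 / 2 : ℝ) := by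
  have h := Finset.sum_mul_sq_le_sq_mul_sq s a (fun i ↦ a i ^ 2)
  have e1 : ∑ i ∈ s, a i ^ 3 = ∑ i ∈ s, a i * a i ^ 2 := Finset.sum_congr rfl fun i _ ↦ by ring
  have e2 : ∑ i ∈ s, (a i ^ 2) ^ 2 = ∑ i ∈ s, a i ^ 4 := Finset.sum_congr rfl fun i _ ↦ by ring
  rw [e2] at h
  have h2 : 0 ≤ ∑ i ∈ s, a i ^ 2 := Finset.sum_nonneg fun i _ ↦ by positivity
  have h4 : 0 ≤ ∑ i ∈ s, a i ^ 4 := Finset.sum_nonneg fun i _ ↦ by positivity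
  have h0 : 0 ≤ ∑ i ∈ s, a i * a i ^ 2 := Finset.sum_nonneg fun i hi ↦ by
    have := ha i hi; positivity
  rw [e1, ← Real.mul_rpow h2 h4]
  calc ∑ i ∈ s, a i * a i ^ 2 = ((∑ i ∈ s, a i * a i ^ 2) ^ 2) ^ (1 / 2 : ℝ) := by
        rw [← Real.sqrt_eq_rpow, Real.sqrt_sq h0]
    _ ≤ ((∑ i ∈ s, a i ^ 2) * ∑ i ∈ s, a i ^ 4) ^ (1 / 2 : ℝ) :=
        Real.rpow_le_rpow (sq_nonneg _) h (by norm_num)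

/-- Cauchy–Schwarz: `∑ a^{1/2} b^{1/2} ≤ (∑ a)^{1/2} (∑ b)^{1/2}` for `a, b ≥ 0`. [folklore] -/
theorem sum_rpow_half_mul_le {ι : Type*} (s : Finset ι) (a b : ι → ℝ) (ha : ∀ i ∈ s, 0 ≤ a i)
    (hb : ∀ i ∈ s, 0 ≤ b i) :
    ∑ i ∈ s, a i ^ (1 / 2 : ℝ) * b i ^ (1 / 2 : ℝ) ≤
      (∑ i ∈ s, a i) ^ (1 / 2 : ℝ) * (∑ i ∈ s, b i) ^ (1 / 2 : ℝ) := by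
  have h := Finset.sum_mul_sq_le_sq_mul_sq s (fun i ↦ a i ^ (1 / 2 : ℝ)) (fun i ↦ b i ^ (1 / 2 : ℝ))
  have ea : ∑ i ∈ s, (a i ^ (1 / 2 : ℝ)) ^ 2 = ∑ i ∈ s, a i := by
    refine Finset.sum_congr rfl fun i hi ↦ ?_
    rw [← Real.rpow_natCast, ← Real.rpow_mul (ha i hi)]; norm_num
  have eb : ∑ i ∈ s, (b i ^ (1 / 2 : ℝ)) ^ 2 = ∑ i ∈ s, b i := by
    refine Finset.sum_congr rfl fun i hi ↦ ?_
    rw [← Real.rpow_natCast, ← Real.rpow_mul (hb i hi)]; norm_num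
  rw [ea, eb] at h
  have hA : 0 ≤ ∑ i ∈ s, a i := Finset.sum_nonneg ha
  have hB : 0 ≤ ∑ i ∈ s, b i := Finset.sum_nonneg hb
  have h0 : 0 ≤ ∑ i ∈ s, a i ^ (1 / 2 : ℝ) * b i ^ (1 / 2 : ℝ) :=
    Finset.sum_nonneg fun i hi ↦ mul_nonneg (Real.rpow_nonneg (ha i hi) _) (Real.rpow_nonneg (hb i hi) _)
  rw [← Real.mul_rpow hA hB]
  calc ∑ i ∈ s, a i ^ (1 / 2 : ℝ) * b i ^ (1 / 2 : ℝ)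
      = ((∑ i ∈ s, a i ^ (1 / 2 : ℝ) * b i ^ (1 / 2 : ℝ)) ^ 2) ^ (1 / 2 : ℝ) := by
        rw [← Real.sqrt_eq_rpow, Real.sqrt_sq h0]
    _ ≤ ((∑ i ∈ s, a i) * ∑ i ∈ s, b i) ^ (1 / 2 : ℝ) :=
        Real.rpow_le_rpow (sq_nonneg _) h (by norm_num)

/-- The cubic sum over a square is at most the geometric mean of the second and fourth moments:
`∑_{m₁,m₂∈[M,2M]} |R|³ ≤ (∑ |R|²)^{1/2} (∑ |R|⁴)^{1/2}`. [cite: GuthMaynard2026, proof of Lemma 11.9] -/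
theorem square_cube_le (W : Finset ℝ) (M : ℕ) :
    ∑ m₁ ∈ Finset.Icc M (2 * M), ∑ m₂ ∈ Finset.Icc M (2 * M), ‖Rfun W ((m₁ : ℝ) / m₂)‖ ^ 3 ≤
      (∑ m₁ ∈ Finset.Icc M (2 * M), ∑ m₂ ∈ Finset.Icc M (2 * M), ‖Rfun W ((m₁ : ℝ) / m₂)‖ ^ 2) ^
          (1 / 2 : ℝ) *
        (∑ m₁ ∈ Finset.Icc M (2 * M), ∑ m₂ ∈ Finset.Icc M (2 * M), ‖Rfun W ((m₁ : ℝ) / m₂)‖ ^ 4) ^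
          (1 / 2 : ℝ) := by
  have e : ∀ k : ℕ, ∑ m₁ ∈ Finset.Icc M (2 * M), ∑ m₂ ∈ Finset.Icc M (2 * M),
      ‖Rfun W ((m₁ : ℝ) / m₂)‖ ^ k =
      ∑ q ∈ Finset.Icc M (2 * M) ×ˢ Finset.Icc M (2 * M), ‖Rfun W ((q.1 : ℝ) / q.2)‖ ^ k :=
    fun k ↦ (Finset.sum_product' _ _ fun m₁ m₂ : ℕ ↦ ‖Rfun W ((m₁ : ℝ) / m₂)‖ ^ k).symm
  rw [e 3, e 2, e 4]
  exact sum_cube_le _ _ fun q _ ↦ norm_nonneg _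

/-! ## §3. Large GCD terms (Guth–Maynard Lemma 11.9) -/

set_option maxHeartbeats 1600000 in
/-- **Guth–Maynard Lemma 11.9 (Large GCD terms), before the case analysis** (eq. (11.24) of the
paper): for every `η > 0` there is `C` such that for `N, D ≥ 1`, `T ≥ 1` and finite `1`-separated
`W ⊂ [t₀, t₀+T]`,
`∑_{D<d≤2N} ∑_{gcd(n₁,n₂)=d} |R(n₁/n₂)|³ ≤ C T^η (1 + log 2N) A^{1/2} B^{1/2}`, where
`A = |W|²N + |W|N²/D + |W|^{5/4}T^{1/2}N` and `B = |W|⁴N + (N²/D)E(W) + E(W)^{3/4}|W|T^{1/2}N`: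
Cauchy–Schwarz in `(n₁',n₂')`, Lemmas 11.5 and 11.6 with `M = ⌈N/d⌉`, Cauchy–Schwarz in `d`, and
`∑_{d>D} M_d ≤ 2N(1+log 2N)`, `∑_{d>D} M_d² ≤ 4N²/D`. [cite: GuthMaynard2026, Lemma 11.9, (11.24)] -/
theorem large_gcd_third_moment {η : ℝ} (hη : 0 < η) :
    ∃ C, 0 ≤ C ∧ ∀ (N D : ℕ), 1 ≤ N → 1 ≤ D → ∀ (T t₀ : ℝ), 1 ≤ T → ∀ (W : Finset ℝ),
      (∀ t ∈ W, t₀ ≤ t ∧ t ≤ t₀ + T) → (∀ t ∈ W, ∀ t' ∈ W, t ≠ t' → 1 ≤ |t - t'|) →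
      ∑ d ∈ Finset.Ioc D (2 * N), ∑ p ∈ gcdPairs N d, ‖Rfun W ((p.1 : ℝ) / p.2)‖ ^ 3 ≤
        C * T ^ η * (1 + Real.log ((2 * N : ℕ) : ℝ)) *
          ((W.card : ℝ) ^ 2 * N + (W.card : ℝ) * (N : ℝ) ^ 2 / D +
              (W.card : ℝ) ^ (5 / 4 : ℝ) * T ^ (1 / 2 : ℝ) * N) ^ (1 / 2 : ℝ) *
          ((W.card : ℝ) ^ 4 * N + (N : ℝ) ^ 2 / D * ((((W ×ˢ W) ×ˢ (W ×ˢ W)).filter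
              (fun q : (ℝ × ℝ) × (ℝ × ℝ) ↦ |q.1.1 + q.1.2 - q.2.1 - q.2.2| ≤ 1)).card : ℝ) +
            (((((W ×ˢ W) ×ˢ (W ×ˢ W)).filter
              (fun q : (ℝ × ℝ) × (ℝ × ℝ) ↦ |q.1.1 + q.1.2 - q.2.1 - q.2.2| ≤ 1)).card : ℝ)) ^
                (3 / 4 : ℝ) * W.card * T ^ (1 / 2 : ℝ) * N) ^ (1 / 2 : ℝ) := by
  obtain ⟨C₂, hC₂0, hC₂⟩ := discrete_second_moment hη
  obtain ⟨C₄, hC₄0, hC₄⟩ := discrete_fourth_moment hη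
  refine ⟨4 * (C₂ ^ (1 / 2 : ℝ) * C₄ ^ (1 / 2 : ℝ)), by positivity,
    fun N D hN hD T t₀ hT W hW hsep ↦ ?_⟩
  have hT0 : 0 < T := by linarith
  have hN0 : (0 : ℝ) < N := by exact_mod_cast hN
  have hD0 : (0 : ℝ) < D := by exact_mod_cast hD
  set K : ℝ := (W.card : ℝ) with hK
  set E₁ : ℝ := ((((W ×ˢ W) ×ˢ (W ×ˢ W)).filter
    (fun q : (ℝ × ℝ) × (ℝ × ℝ) ↦ |q.1.1 + q.1.2 - q.2.1 - q.2.2| ≤ 1)).card : ℝ) with hE₁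
  have hK0 : 0 ≤ K := Nat.cast_nonneg _
  have hE₁0 : 0 ≤ E₁ := Nat.cast_nonneg _
  set Md : ℕ → ℕ := fun d ↦ ⌈(N : ℝ) / d⌉₊ with hMd
  -- the second and fourth moments over the reduced squares
  set a : ℕ → ℝ := fun d ↦ ∑ m₁ ∈ Finset.Icc (Md d) (2 * Md d), ∑ m₂ ∈ Finset.Icc (Md d) (2 * Md d),
    ‖Rfun W ((m₁ : ℝ) / m₂)‖ ^ 2 with ha
  set b : ℕ → ℝ := fun d ↦ ∑ m₁ ∈ Finset.Icc (Md d) (2 * Md d), ∑ m₂ ∈ Finset.Icc (Md d) (2 * Md d),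
    ‖Rfun W ((m₁ : ℝ) / m₂)‖ ^ 4 with hb
  have ha0 : ∀ d, 0 ≤ a d := fun d ↦ by positivity
  have hb0 : ∀ d, 0 ≤ b d := fun d ↦ by positivity
  -- Step 1: per `d`, injection and Cauchy–Schwarz
  have h1 : ∀ d ∈ Finset.Ioc D (2 * N), ∑ p ∈ gcdPairs N d, ‖Rfun W ((p.1 : ℝ) / p.2)‖ ^ 3 ≤
      a d ^ (1 / 2 : ℝ) * b d ^ (1 / 2 : ℝ) := by
    intro d hd
    rw [Finset.mem_Ioc] at hd
    exact (sum_gcdPairs_le_square W hN (by omega) 3).trans (square_cube_le W (Md d))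
  -- Step 2: Cauchy–Schwarz in `d`
  have h2 : ∑ d ∈ Finset.Ioc D (2 * N), ∑ p ∈ gcdPairs N d, ‖Rfun W ((p.1 : ℝ) / p.2)‖ ^ 3 ≤
      (∑ d ∈ Finset.Ioc D (2 * N), a d) ^ (1 / 2 : ℝ) * (∑ d ∈ Finset.Ioc D (2 * N), b d) ^ (1 / 2 : ℝ) :=
    (Finset.sum_le_sum h1).trans (sum_rpow_half_mul_le _ a b (fun d _ ↦ ha0 d) fun d _ ↦ hb0 d)
  -- Step 3: the moment bounds summed over `d`
  have hMd1 : ∀ d ∈ Finset.Ioc D (2 * N), 1 ≤ Md d := by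
    intro d hd
    rw [Finset.mem_Ioc] at hd
    exact one_le_ceil_div hN (by omega)
  set L : ℝ := 1 + Real.log ((2 * N : ℕ) : ℝ) with hL
  have hL1 : 1 ≤ L := by
    have : 0 ≤ Real.log ((2 * N : ℕ) : ℝ) := Real.log_nonneg (by exact_mod_cast (show 1 ≤ 2 * N by omega))
    linarith
  have hS1 : ∑ d ∈ Finset.Ioc D (2 * N), (Md d : ℝ) ≤ 2 * N * L := sum_ceil_div_le N D
  have hS2 : ∑ d ∈ Finset.Ioc D (2 * N), (Md d : ℝ) ^ 2 ≤ 4 * (N : ℝ) ^ 2 / D := sum_ceil_div_sq_le N hD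
  have hA : ∑ d ∈ Finset.Ioc D (2 * N), a d ≤ 4 * C₂ * T ^ η * L *
      (K ^ 2 * N + K * (N : ℝ) ^ 2 / D + K ^ (5 / 4 : ℝ) * T ^ (1 / 2 : ℝ) * N) := by
    have hterm : ∀ d ∈ Finset.Ioc D (2 * N), a d ≤ C₂ * T ^ η * (K ^ 2 * (Md d : ℝ) + K * (Md d : ℝ) ^ 2 +
        K ^ (5 / 4 : ℝ) * T ^ (1 / 2 : ℝ) * (Md d : ℝ)) := fun d hd ↦
      hC₂ (Md d) T t₀ W (hMd1 d hd) hT hW hsep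
    calc ∑ d ∈ Finset.Ioc D (2 * N), a d
        ≤ ∑ d ∈ Finset.Ioc D (2 * N), C₂ * T ^ η * (K ^ 2 * (Md d : ℝ) + K * (Md d : ℝ) ^ 2 +
            K ^ (5 / 4 : ℝ) * T ^ (1 / 2 : ℝ) * (Md d : ℝ)) := Finset.sum_le_sum hterm
      _ = C₂ * T ^ η * (K ^ 2 * ∑ d ∈ Finset.Ioc D (2 * N), (Md d : ℝ) +
            K * ∑ d ∈ Finset.Ioc D (2 * N), (Md d : ℝ) ^ 2 +
            K ^ (5 / 4 : ℝ) * T ^ (1 / 2 : ℝ) * ∑ d ∈ Finset.Ioc D (2 * N), (Md d : ℝ)) := by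
          rw [← Finset.mul_sum, Finset.sum_add_distrib, Finset.sum_add_distrib, ← Finset.mul_sum,
            ← Finset.mul_sum, ← Finset.mul_sum]
      _ ≤ C₂ * T ^ η * (K ^ 2 * (2 * N * L) + K * (4 * (N : ℝ) ^ 2 / D) +
            K ^ (5 / 4 : ℝ) * T ^ (1 / 2 : ℝ) * (2 * N * L)) := by
          gcongr
      _ ≤ 4 * C₂ * T ^ η * L * (K ^ 2 * N + K * (N : ℝ) ^ 2 / D + K ^ (5 / 4 : ℝ) * T ^ (1 / 2 : ℝ) * N) := by
          have hx : 0 ≤ C₂ * T ^ η := by positivity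
          have h3 : K ^ 2 * (2 * N * L) ≤ 4 * L * (K ^ 2 * N) := by
            have : 0 ≤ L * (K ^ 2 * N) := by positivity
            nlinarith
          have h4 : K * (4 * (N : ℝ) ^ 2 / D) ≤ 4 * L * (K * (N : ℝ) ^ 2 / D) := by
            have h0 : 0 ≤ K * (N : ℝ) ^ 2 / D := by positivity
            have : K * (4 * (N : ℝ) ^ 2 / D) = 4 * 1 * (K * (N : ℝ) ^ 2 / D) := by ring
            rw [this]; gcongr
          have h5 : K ^ (5 / 4 : ℝ) * T ^ (1 / 2 : ℝ) * (2 * N * L) ≤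
              4 * L * (K ^ (5 / 4 : ℝ) * T ^ (1 / 2 : ℝ) * N) := by
            have : 0 ≤ L * (K ^ (5 / 4 : ℝ) * T ^ (1 / 2 : ℝ) * N) := by positivity
            nlinarith
          calc C₂ * T ^ η * (K ^ 2 * (2 * N * L) + K * (4 * (N : ℝ) ^ 2 / D) +
                K ^ (5 / 4 : ℝ) * T ^ (1 / 2 : ℝ) * (2 * N * L))
              ≤ C₂ * T ^ η * (4 * L * (K ^ 2 * N) + 4 * L * (K * (N : ℝ) ^ 2 / D) +
                4 * L * (K ^ (5 / 4 : ℝ) * T ^ (1 / 2 : ℝ) * N)) := by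
                gcongr
            _ = _ := by ring
  have hB : ∑ d ∈ Finset.Ioc D (2 * N), b d ≤ 4 * C₄ * T ^ η * L *
      (K ^ 4 * N + (N : ℝ) ^ 2 / D * E₁ + E₁ ^ (3 / 4 : ℝ) * K * T ^ (1 / 2 : ℝ) * N) := by
    have hterm : ∀ d ∈ Finset.Ioc D (2 * N), b d ≤ C₄ * T ^ η * (K ^ 4 * (Md d : ℝ) + (Md d : ℝ) ^ 2 * E₁ +
        E₁ ^ (3 / 4 : ℝ) * K * T ^ (1 / 2 : ℝ) * (Md d : ℝ)) := fun d hd ↦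
      hC₄ (Md d) T t₀ W (hMd1 d hd) hT hW hsep
    calc ∑ d ∈ Finset.Ioc D (2 * N), b d
        ≤ ∑ d ∈ Finset.Ioc D (2 * N), C₄ * T ^ η * (K ^ 4 * (Md d : ℝ) + (Md d : ℝ) ^ 2 * E₁ +
            E₁ ^ (3 / 4 : ℝ) * K * T ^ (1 / 2 : ℝ) * (Md d : ℝ)) := Finset.sum_le_sum hterm
      _ = C₄ * T ^ η * (K ^ 4 * ∑ d ∈ Finset.Ioc D (2 * N), (Md d : ℝ) +
            (∑ d ∈ Finset.Ioc D (2 * N), (Md d : ℝ) ^ 2) * E₁ +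
            E₁ ^ (3 / 4 : ℝ) * K * T ^ (1 / 2 : ℝ) * ∑ d ∈ Finset.Ioc D (2 * N), (Md d : ℝ)) := by
          rw [← Finset.mul_sum, Finset.sum_add_distrib, Finset.sum_add_distrib, ← Finset.mul_sum,
            ← Finset.sum_mul, ← Finset.mul_sum]
      _ ≤ C₄ * T ^ η * (K ^ 4 * (2 * N * L) + (4 * (N : ℝ) ^ 2 / D) * E₁ +
            E₁ ^ (3 / 4 : ℝ) * K * T ^ (1 / 2 : ℝ) * (2 * N * L)) := by
          gcongr
      _ ≤ 4 * C₄ * T ^ η * L * (K ^ 4 * N + (N : ℝ) ^ 2 / D * E₁ + E₁ ^ (3 / 4 : ℝ) * K * T ^ (1 / 2 : ℝ) * N) := by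
          have h3 : K ^ 4 * (2 * N * L) ≤ 4 * L * (K ^ 4 * N) := by
            have : 0 ≤ L * (K ^ 4 * N) := by positivity
            nlinarith
          have h4 : (4 * (N : ℝ) ^ 2 / D) * E₁ ≤ 4 * L * ((N : ℝ) ^ 2 / D * E₁) := by
            have h0 : 0 ≤ (N : ℝ) ^ 2 / D * E₁ := by positivity
            have : (4 * (N : ℝ) ^ 2 / D) * E₁ = 4 * 1 * ((N : ℝ) ^ 2 / D * E₁) := by ring
            rw [this]; gcongr
          have h5 : E₁ ^ (3 / 4 : ℝ) * K * T ^ (1 / 2 : ℝ) * (2 * N * L) ≤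
              4 * L * (E₁ ^ (3 / 4 : ℝ) * K * T ^ (1 / 2 : ℝ) * N) := by
            have : 0 ≤ L * (E₁ ^ (3 / 4 : ℝ) * K * T ^ (1 / 2 : ℝ) * N) := by positivity
            nlinarith
          calc C₄ * T ^ η * (K ^ 4 * (2 * N * L) + (4 * (N : ℝ) ^ 2 / D) * E₁ +
                E₁ ^ (3 / 4 : ℝ) * K * T ^ (1 / 2 : ℝ) * (2 * N * L))
              ≤ C₄ * T ^ η * (4 * L * (K ^ 4 * N) + 4 * L * ((N : ℝ) ^ 2 / D * E₁) +
                4 * L * (E₁ ^ (3 / 4 : ℝ) * K * T ^ (1 / 2 : ℝ) * N)) := by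
                gcongr
            _ = _ := by ring
  -- Step 4: combine
  set A₀ : ℝ := K ^ 2 * N + K * (N : ℝ) ^ 2 / D + K ^ (5 / 4 : ℝ) * T ^ (1 / 2 : ℝ) * N with hA₀
  set B₀ : ℝ := K ^ 4 * N + (N : ℝ) ^ 2 / D * E₁ + E₁ ^ (3 / 4 : ℝ) * K * T ^ (1 / 2 : ℝ) * N with hB₀
  have hA₀0 : 0 ≤ A₀ := by positivity
  have hB₀0 : 0 ≤ B₀ := by positivity
  have hsumA0 : 0 ≤ ∑ d ∈ Finset.Ioc D (2 * N), a d := Finset.sum_nonneg fun d _ ↦ ha0 d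
  have hsumB0 : 0 ≤ ∑ d ∈ Finset.Ioc D (2 * N), b d := Finset.sum_nonneg fun d _ ↦ hb0 d
  have hx : 0 ≤ 4 * T ^ η * L := by positivity
  calc ∑ d ∈ Finset.Ioc D (2 * N), ∑ p ∈ gcdPairs N d, ‖Rfun W ((p.1 : ℝ) / p.2)‖ ^ 3
      ≤ (∑ d ∈ Finset.Ioc D (2 * N), a d) ^ (1 / 2 : ℝ) * (∑ d ∈ Finset.Ioc D (2 * N), b d) ^ (1 / 2 : ℝ) := h2
    _ ≤ (4 * C₂ * T ^ η * L * A₀) ^ (1 / 2 : ℝ) * (4 * C₄ * T ^ η * L * B₀) ^ (1 / 2 : ℝ) :=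
        mul_le_mul (Real.rpow_le_rpow hsumA0 hA (by norm_num)) (Real.rpow_le_rpow hsumB0 hB (by norm_num))
          (Real.rpow_nonneg hsumB0 _) (Real.rpow_nonneg (by positivity) _)
    _ = ((4 * T ^ η * L) * (C₂ * A₀)) ^ (1 / 2 : ℝ) * ((4 * T ^ η * L) * (C₄ * B₀)) ^ (1 / 2 : ℝ) := by
        congr 2 <;> ring
    _ = (4 * T ^ η * L) ^ (1 / 2 : ℝ) * (4 * T ^ η * L) ^ (1 / 2 : ℝ) *
          ((C₂ * A₀) ^ (1 / 2 : ℝ) * (C₄ * B₀) ^ (1 / 2 : ℝ)) := by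
        rw [Real.mul_rpow hx (by positivity), Real.mul_rpow hx (by positivity)]; ring
    _ = (4 * T ^ η * L) * (C₂ ^ (1 / 2 : ℝ) * C₄ ^ (1 / 2 : ℝ)) * (A₀ ^ (1 / 2 : ℝ) * B₀ ^ (1 / 2 : ℝ)) := by
        rw [← Real.mul_rpow hx hx, ← sq, ← Real.rpow_natCast, ← Real.rpow_mul hx,
          Real.mul_rpow hC₂0 hA₀0, Real.mul_rpow hC₄0 hB₀0]
        norm_num; ring
    _ = 4 * (C₂ ^ (1 / 2 : ℝ) * C₄ ^ (1 / 2 : ℝ)) * T ^ η * L * A₀ ^ (1 / 2 : ℝ) * B₀ ^ (1 / 2 : ℝ) := by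
        ring

set_option maxHeartbeats 1600000 in
/-- **The case analysis of Lemma 11.9 as an inequality between reals** (eqs. (11.25)–(11.27) of
the paper, for `T = N^{6/5}`, written in powers of `N`: `T^{1/2} = N^{3/5}`, `T^{1/4} = N^{3/10}`):
if `N ≥ 1`, `K ≥ 1` and `K² ≤ E ≤ 3K³` then, with `A₀ = K²N + KN^{6/5} + K^{5/4}N^{8/5}` and
`B₀ = K⁴N + N^{6/5}E + E^{3/4}KN^{8/5}`,
`A₀^{1/2} B₀^{1/2} ≤ 5K³N + 2K^{21/8}N^{13/10} + 4E^{1/2}K^{1/2}N²`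
(case `K^{3/4} ≥ T^{1/2}`: `A₀ ≤ 3K²N`, `B₀ ≤ 7K⁴N`; case `K^{3/4} ≤ T^{1/2}`: `A₀ ≤ 3K^{5/4}T^{1/2}N`
and the three products are `≤ 3u², 3v², 3v²` with `u = K^{21/8}T^{1/4}N`, `v = E^{1/2}K^{1/2}N²`).
[cite: GuthMaynard2026, proof of Lemma 11.9, (11.25)–(11.27)] -/
theorem large_gcd_algebra {N K E : ℝ} (hN : 1 ≤ N) (hK : 1 ≤ K) (hEK : K ^ 2 ≤ E) (hE3 : E ≤ 3 * K ^ 3) :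
    (K ^ 2 * N + K * N ^ (6 / 5 : ℝ) + K ^ (5 / 4 : ℝ) * N ^ (8 / 5 : ℝ)) ^ (1 / 2 : ℝ) *
      (K ^ 4 * N + N ^ (6 / 5 : ℝ) * E + E ^ (3 / 4 : ℝ) * K * N ^ (8 / 5 : ℝ)) ^ (1 / 2 : ℝ) ≤
      5 * K ^ 3 * N + 2 * K ^ (21 / 8 : ℝ) * N ^ (13 / 10 : ℝ) +
        4 * E ^ (1 / 2 : ℝ) * K ^ (1 / 2 : ℝ) * N ^ 2 := by
  have hN0 : 0 < N := by linarith
  have hK0 : 0 < K := by linarith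
  have hE0 : 0 < E := by nlinarith
  have hN1 : ∀ {a b : ℝ}, a ≤ b → N ^ a ≤ N ^ b := fun h ↦ Real.rpow_le_rpow_of_exponent_le hN h
  have hK1 : ∀ {a b : ℝ}, a ≤ b → K ^ a ≤ K ^ b := fun h ↦ Real.rpow_le_rpow_of_exponent_le hK h
  set A₀ : ℝ := K ^ 2 * N + K * N ^ (6 / 5 : ℝ) + K ^ (5 / 4 : ℝ) * N ^ (8 / 5 : ℝ) with hA₀
  set B₀ : ℝ := K ^ 4 * N + N ^ (6 / 5 : ℝ) * E + E ^ (3 / 4 : ℝ) * K * N ^ (8 / 5 : ℝ) with hB₀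
  set u : ℝ := K ^ (21 / 8 : ℝ) * N ^ (13 / 10 : ℝ) with hu
  set v : ℝ := E ^ (1 / 2 : ℝ) * K ^ (1 / 2 : ℝ) * N ^ 2 with hv
  set Z : ℝ := 5 * K ^ 3 * N + 2 * u + 4 * v with hZ
  have hA₀0 : 0 ≤ A₀ := by positivity
  have hB₀0 : 0 ≤ B₀ := by positivity
  have hu0 : 0 ≤ u := by positivity
  have hv0 : 0 ≤ v := by positivity
  have hZ0 : 0 ≤ Z := by positivity
  -- some power identities
  have eK2 : K ^ (5 / 4 : ℝ) * K ^ (3 / 4 : ℝ) = K ^ 2 := by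
    rw [← Real.rpow_add hK0]; norm_num
  have eN85 : N ^ (3 / 5 : ℝ) * N = N ^ (8 / 5 : ℝ) := by
    rw [show N ^ (3 / 5 : ℝ) * N = N ^ (3 / 5 : ℝ) * N ^ (1 : ℝ) by rw [Real.rpow_one],
      ← Real.rpow_add hN0]; norm_num
  have eE34 : E ^ (3 / 4 : ℝ) ≤ 3 * K ^ (9 / 4 : ℝ) := by
    calc E ^ (3 / 4 : ℝ) ≤ (3 * K ^ 3) ^ (3 / 4 : ℝ) := Real.rpow_le_rpow hE0.le hE3 (by norm_num)
      _ = (3 : ℝ) ^ (3 / 4 : ℝ) * K ^ (9 / 4 : ℝ) := by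
          rw [Real.mul_rpow (by norm_num) (by positivity), show (K ^ 3) ^ (3 / 4 : ℝ) = K ^ (9 / 4 : ℝ) by
            rw [show K ^ 3 = K ^ (3 : ℝ) by norm_cast, ← Real.rpow_mul hK0.le]; norm_num]
      _ ≤ 3 * K ^ (9 / 4 : ℝ) := by
          gcongr
          calc (3 : ℝ) ^ (3 / 4 : ℝ) ≤ (3 : ℝ) ^ (1 : ℝ) :=
                Real.rpow_le_rpow_of_exponent_le (by norm_num) (by norm_num)
            _ = 3 := Real.rpow_one 3
  -- first term of `A₀`: `K N^{6/5} ≤ K^{5/4} N^{8/5}`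
  have hA2 : K * N ^ (6 / 5 : ℝ) ≤ K ^ (5 / 4 : ℝ) * N ^ (8 / 5 : ℝ) := by
    have h1 : K ≤ K ^ (5 / 4 : ℝ) := by
      calc K = K ^ (1 : ℝ) := (Real.rpow_one K).symm
        _ ≤ K ^ (5 / 4 : ℝ) := hK1 (by norm_num)
    exact mul_le_mul h1 (hN1 (by norm_num)) (by positivity) (by positivity)
  -- main claim: `A₀ B₀ ≤ Z²`
  have hmain : A₀ * B₀ ≤ Z ^ 2 := by
    rcases le_or_gt (N ^ (3 / 5 : ℝ)) (K ^ (3 / 4 : ℝ)) with hcase | hcase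
    · -- Case 1: `T^{1/2} ≤ K^{3/4}`
      have hA3 : K ^ (5 / 4 : ℝ) * N ^ (8 / 5 : ℝ) ≤ K ^ 2 * N := by
        rw [← eN85, ← mul_assoc, ← eK2]
        exact mul_le_mul_of_nonneg_right (mul_le_mul_of_nonneg_left hcase (by positivity)) hN0.le
      have hA : A₀ ≤ 3 * (K ^ 2 * N) := by rw [hA₀]; linarith
      have hKN : N ^ (1 / 5 : ℝ) ≤ K := by
        have h1 : N ^ (1 / 5 : ℝ) ≤ N ^ (3 / 5 : ℝ) := hN1 (by norm_num)
        have h2 : K ^ (3 / 4 : ℝ) ≤ K ^ (1 : ℝ) := hK1 (by norm_num)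
        rw [Real.rpow_one] at h2
        linarith
      have hB2 : N ^ (6 / 5 : ℝ) * E ≤ 3 * (K ^ 4 * N) := by
        have e1 : N ^ (6 / 5 : ℝ) = N ^ (1 / 5 : ℝ) * N := by
          rw [show N ^ (1 / 5 : ℝ) * N = N ^ (1 / 5 : ℝ) * N ^ (1 : ℝ) by rw [Real.rpow_one],
            ← Real.rpow_add hN0]; norm_num
        rw [e1]
        calc N ^ (1 / 5 : ℝ) * N * E ≤ K * N * (3 * K ^ 3) := by gcongr
          _ = 3 * (K ^ 4 * N) := by ring
      have hB3 : E ^ (3 / 4 : ℝ) * K * N ^ (8 / 5 : ℝ) ≤ 3 * (K ^ 4 * N) := by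
        have e1 : K ^ (9 / 4 : ℝ) * K * K ^ (3 / 4 : ℝ) = K ^ 4 := by
          rw [show K ^ (9 / 4 : ℝ) * K = K ^ (9 / 4 : ℝ) * K ^ (1 : ℝ) by rw [Real.rpow_one],
            ← Real.rpow_add hK0, ← Real.rpow_add hK0]; norm_num
        calc E ^ (3 / 4 : ℝ) * K * N ^ (8 / 5 : ℝ) ≤ (3 * K ^ (9 / 4 : ℝ)) * K * (K ^ (3 / 4 : ℝ) * N) := by
              rw [← eN85]; gcongr
          _ = 3 * (K ^ 4 * N) := by rw [← e1]; ring
      have hB : B₀ ≤ 7 * (K ^ 4 * N) := by rw [hB₀]; linarith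
      calc A₀ * B₀ ≤ (3 * (K ^ 2 * N)) * (7 * (K ^ 4 * N)) := mul_le_mul hA hB hB₀0 (by positivity)
        _ = 21 * (K ^ 3 * N) ^ 2 := by ring
        _ ≤ (5 * K ^ 3 * N) ^ 2 := by nlinarith [sq_nonneg (K ^ 3 * N)]
        _ ≤ Z ^ 2 := by
            refine pow_le_pow_left₀ (by positivity) ?_ 2
            rw [hZ]; linarith
    · -- Case 2: `K^{3/4} ≤ T^{1/2}`
      have hc := hcase.le
      have hA1 : K ^ 2 * N ≤ K ^ (5 / 4 : ℝ) * N ^ (8 / 5 : ℝ) := by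
        rw [← eK2, ← eN85, mul_assoc]
        exact mul_le_mul_of_nonneg_left (mul_le_mul_of_nonneg_right hc hN0.le) (by positivity)
      have hA : A₀ ≤ 3 * (K ^ (5 / 4 : ℝ) * N ^ (8 / 5 : ℝ)) := by rw [hA₀]; linarith
      -- the three products
      have hP1 : K ^ (5 / 4 : ℝ) * N ^ (8 / 5 : ℝ) * (K ^ 4 * N) = u ^ 2 := by
        rw [hu, mul_pow, ← Real.rpow_natCast (K ^ (21 / 8 : ℝ)) 2, ← Real.rpow_natCast (N ^ (13 / 10 : ℝ)) 2,
          ← Real.rpow_mul hK0.le, ← Real.rpow_mul hN0.le]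
        have e1 : K ^ (5 / 4 : ℝ) * K ^ 4 = K ^ ((21 / 8 : ℝ) * (2 : ℕ)) := by
          rw [show K ^ 4 = K ^ (4 : ℝ) by norm_cast, ← Real.rpow_add hK0]; norm_num
        have e2 : N ^ (8 / 5 : ℝ) * N = N ^ ((13 / 10 : ℝ) * (2 : ℕ)) := by
          rw [show N ^ (8 / 5 : ℝ) * N = N ^ (8 / 5 : ℝ) * N ^ (1 : ℝ) by rw [Real.rpow_one],
            ← Real.rpow_add hN0]; norm_num
        rw [← e1, ← e2]; ring
      have hv2 : v ^ 2 = E * K * N ^ 4 := by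
        have e1 : (E ^ (1 / 2 : ℝ)) ^ 2 = E := by
          rw [← Real.rpow_natCast, ← Real.rpow_mul hE0.le]; norm_num
        have e2 : (K ^ (1 / 2 : ℝ)) ^ 2 = K := by
          rw [← Real.rpow_natCast, ← Real.rpow_mul hK0.le]; norm_num
        rw [hv, mul_pow, mul_pow, e1, e2]; ring
      have hK14 : K ^ (1 / 4 : ℝ) ≤ N ^ (6 / 5 : ℝ) := by
        calc K ^ (1 / 4 : ℝ) ≤ K ^ (3 / 4 : ℝ) := hK1 (by norm_num)
          _ ≤ N ^ (3 / 5 : ℝ) := hc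
          _ ≤ N ^ (6 / 5 : ℝ) := hN1 (by norm_num)
      have hP2 : K ^ (5 / 4 : ℝ) * N ^ (8 / 5 : ℝ) * (N ^ (6 / 5 : ℝ) * E) ≤ v ^ 2 := by
        rw [hv2]
        have e1 : K ^ (5 / 4 : ℝ) = K ^ (1 / 4 : ℝ) * K := by
          rw [show K ^ (1 / 4 : ℝ) * K = K ^ (1 / 4 : ℝ) * K ^ (1 : ℝ) by rw [Real.rpow_one],
            ← Real.rpow_add hK0]; norm_num
        have e2 : N ^ (8 / 5 : ℝ) * N ^ (6 / 5 : ℝ) * N ^ (6 / 5 : ℝ) = N ^ 4 := by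
          rw [← Real.rpow_add hN0, ← Real.rpow_add hN0, show N ^ 4 = N ^ (4 : ℝ) by norm_cast]; norm_num
        calc K ^ (5 / 4 : ℝ) * N ^ (8 / 5 : ℝ) * (N ^ (6 / 5 : ℝ) * E)
            = K ^ (1 / 4 : ℝ) * (K * E * (N ^ (8 / 5 : ℝ) * N ^ (6 / 5 : ℝ))) := by rw [e1]; ring
          _ ≤ N ^ (6 / 5 : ℝ) * (K * E * (N ^ (8 / 5 : ℝ) * N ^ (6 / 5 : ℝ))) :=
              mul_le_mul_of_nonneg_right hK14 (by positivity)
          _ = E * K * N ^ 4 := by rw [← e2]; ring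
      have hE14 : K ^ (1 / 2 : ℝ) ≤ E ^ (1 / 4 : ℝ) := by
        calc K ^ (1 / 2 : ℝ) = (K ^ 2) ^ (1 / 4 : ℝ) := by
              rw [show K ^ 2 = K ^ (2 : ℝ) by norm_cast, ← Real.rpow_mul hK0.le]; norm_num
          _ ≤ E ^ (1 / 4 : ℝ) := Real.rpow_le_rpow (by positivity) hEK (by norm_num)
      have hP3 : K ^ (5 / 4 : ℝ) * N ^ (8 / 5 : ℝ) * (E ^ (3 / 4 : ℝ) * K * N ^ (8 / 5 : ℝ)) ≤ v ^ 2 := by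
        rw [hv2]
        -- `K^{5/4}·K = K^{9/4} = K^{1/2}·K^{3/4}·K ≤ E^{1/4} N^{3/5} K` and `E^{3/4}E^{1/4} = E`
        have e1 : K ^ (5 / 4 : ℝ) * K = K ^ (1 / 2 : ℝ) * K ^ (3 / 4 : ℝ) * K := by
          rw [← Real.rpow_add hK0]; norm_num
        have e2 : E ^ (3 / 4 : ℝ) * E ^ (1 / 4 : ℝ) = E := by
          rw [← Real.rpow_add hE0]; norm_num
        have e3 : N ^ (8 / 5 : ℝ) * N ^ (8 / 5 : ℝ) * N ^ (3 / 5 : ℝ) ≤ N ^ 4 := by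
          rw [← Real.rpow_add hN0, ← Real.rpow_add hN0, show N ^ 4 = N ^ (4 : ℝ) by norm_cast]
          exact hN1 (by norm_num)
        calc K ^ (5 / 4 : ℝ) * N ^ (8 / 5 : ℝ) * (E ^ (3 / 4 : ℝ) * K * N ^ (8 / 5 : ℝ))
            = (K ^ (1 / 2 : ℝ) * K ^ (3 / 4 : ℝ)) * (E ^ (3 / 4 : ℝ) * K * (N ^ (8 / 5 : ℝ) * N ^ (8 / 5 : ℝ))) := by
              rw [show K ^ (5 / 4 : ℝ) * N ^ (8 / 5 : ℝ) * (E ^ (3 / 4 : ℝ) * K * N ^ (8 / 5 : ℝ)) =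
                (K ^ (5 / 4 : ℝ) * K) * (E ^ (3 / 4 : ℝ) * (N ^ (8 / 5 : ℝ) * N ^ (8 / 5 : ℝ))) by ring, e1]
              ring
          _ ≤ (E ^ (1 / 4 : ℝ) * N ^ (3 / 5 : ℝ)) * (E ^ (3 / 4 : ℝ) * K * (N ^ (8 / 5 : ℝ) * N ^ (8 / 5 : ℝ))) := by
              refine mul_le_mul_of_nonneg_right ?_ (by positivity)
              exact mul_le_mul hE14 hc (by positivity) (by positivity)
          _ = (E ^ (3 / 4 : ℝ) * E ^ (1 / 4 : ℝ)) * K * (N ^ (8 / 5 : ℝ) * N ^ (8 / 5 : ℝ) * N ^ (3 / 5 : ℝ)) := by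
              ring
          _ ≤ (E ^ (3 / 4 : ℝ) * E ^ (1 / 4 : ℝ)) * K * N ^ 4 :=
              mul_le_mul_of_nonneg_left e3 (by positivity)
          _ = E * K * N ^ 4 := by rw [e2]
      have hAB : A₀ * B₀ ≤ 3 * u ^ 2 + 6 * v ^ 2 := by
        calc A₀ * B₀ ≤ 3 * (K ^ (5 / 4 : ℝ) * N ^ (8 / 5 : ℝ)) * B₀ := mul_le_mul_of_nonneg_right hA hB₀0
          _ = 3 * (K ^ (5 / 4 : ℝ) * N ^ (8 / 5 : ℝ) * (K ^ 4 * N)) +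
              3 * (K ^ (5 / 4 : ℝ) * N ^ (8 / 5 : ℝ) * (N ^ (6 / 5 : ℝ) * E)) +
              3 * (K ^ (5 / 4 : ℝ) * N ^ (8 / 5 : ℝ) * (E ^ (3 / 4 : ℝ) * K * N ^ (8 / 5 : ℝ))) := by
              rw [hB₀]; ring
          _ ≤ 3 * u ^ 2 + 3 * v ^ 2 + 3 * v ^ 2 := by rw [hP1]; linarith
          _ = 3 * u ^ 2 + 6 * v ^ 2 := by ring
      calc A₀ * B₀ ≤ 3 * u ^ 2 + 6 * v ^ 2 := hAB
        _ ≤ 3 * u ^ 2 + 6 * v ^ 2 + (u ^ 2 + 10 * v ^ 2 + 16 * (u * v)) :=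
            le_add_of_nonneg_right (by have := mul_nonneg hu0 hv0; positivity)
        _ = (2 * u + 4 * v) ^ 2 := by ring
        _ ≤ Z ^ 2 := by
            refine pow_le_pow_left₀ (by positivity) ?_ 2
            rw [hZ]
            have : 0 ≤ 5 * K ^ 3 * N := by positivity
            linarith
  -- conclusion
  calc A₀ ^ (1 / 2 : ℝ) * B₀ ^ (1 / 2 : ℝ) = (A₀ * B₀) ^ (1 / 2 : ℝ) := (Real.mul_rpow hA₀0 hB₀0).symm
    _ ≤ (Z ^ 2) ^ (1 / 2 : ℝ) := Real.rpow_le_rpow (by positivity) hmain (by norm_num)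
    _ = Z := by rw [← Real.sqrt_eq_rpow, Real.sqrt_sq hZ0]
    _ = _ := by rw [hZ, hu, hv]; ring

/-! ## §4. Proposition 11.1 (Bound for energy) for `T = N^{6/5}` -/

/-- `E ≤ X + Y E^{1/2}` implies `E ≤ 2X + Y²` ("This rearranges to give …").
[cite: GuthMaynard2026, proof of Proposition 11.1] -/
theorem le_of_sqrt_bound {E X Y : ℝ} (hE : 0 ≤ E) (h : E ≤ X + Y * E ^ (1 / 2 : ℝ)) :
    E ≤ 2 * X + Y ^ 2 := by
  have e : (E ^ (1 / 2 : ℝ)) ^ 2 = E := by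
    rw [← Real.rpow_natCast, ← Real.rpow_mul hE]; norm_num
  have h1 : Y * E ^ (1 / 2 : ℝ) ≤ (Y ^ 2 + E) / 2 := by
    nlinarith [sq_nonneg (Y - E ^ (1 / 2 : ℝ))]
  linarith

/-- `1 + log(2N) ≤ (1 + 2/η) N^η` for `N ≥ 1`, `0 < η ≤ 1`. [folklore] -/
theorem one_add_log_le {η : ℝ} (hη : 0 < η) (hη1 : η ≤ 1) {n : ℝ} (hn : 1 ≤ n) :
    1 + Real.log (2 * n) ≤ (1 + 2 / η) * n ^ η := by
  have hn0 : 0 < n := by linarith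
  have h1 : Real.log (2 * n) ≤ (2 * n) ^ η / η := Real.log_le_rpow_div (by positivity) hη
  have h2 : (2 * n) ^ η = (2 : ℝ) ^ η * n ^ η := Real.mul_rpow (by norm_num) hn0.le
  have h3 : (2 : ℝ) ^ η ≤ 2 := by
    calc (2 : ℝ) ^ η ≤ (2 : ℝ) ^ (1 : ℝ) := Real.rpow_le_rpow_of_exponent_le (by norm_num) hη1
      _ = 2 := Real.rpow_one 2
  have h4 : 1 ≤ n ^ η := Real.one_le_rpow hn hη.le
  have h5 : (2 * n) ^ η / η ≤ 2 * n ^ η / η := by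
    rw [h2]; gcongr
  calc 1 + Real.log (2 * n) ≤ n ^ η + 2 * n ^ η / η := by linarith
    _ = (1 + 2 / η) * n ^ η := by ring

/-- A `1`-separated finite set in an interval of length `N^{6/5}` has at most `2N^{6/5}` elements.
[folklore] -/
theorem card_le_two_mul {N : ℕ} (hN : 1 ≤ N) {t₀ : ℝ} {W : Finset ℝ}
    (hW : ∀ t ∈ W, t₀ ≤ t ∧ t ≤ t₀ + (N : ℝ) ^ (6 / 5 : ℝ))
    (hsep : ∀ t ∈ W, ∀ t' ∈ W, t ≠ t' → 1 ≤ |t - t'|) :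
    (W.card : ℝ) ≤ 2 * (N : ℝ) ^ (6 / 5 : ℝ) := by
  have hT1 : 1 ≤ (N : ℝ) ^ (6 / 5 : ℝ) := Real.one_le_rpow (by exact_mod_cast hN) (by norm_num)
  have h := SeparatedSums.card_le_of_sep one_pos (by linarith) W hW hsep
  rw [div_one] at h
  linarith

set_option maxHeartbeats 1600000 in
/-- **The small-gcd part of `∑|R|³` in the setting of Proposition 11.1** (eq. (11.23) of the paper
with `D = ⌈N²/T⌉ = ⌈N^{4/5}⌉`, `T = N^{6/5}`): for `η > 0` there is `C` with
`∑_{d≤D} ∑_{gcd=d} |R(n₁/n₂)|³ ≤ C N^η N²|W|^{1/2}E(W)^{1/2} + C N|W|³` for all `N ≥ 1` and finite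
non-empty `1`-separated `W` in an interval of length `N^{6/5}` (Lemma 11.8,
`GuthMaynardSmallGCD.small_gcd_third_moment`, with `Dl = N^η` and `j` so large that
`Dl^{1−j}|W|⁴ ≤ 16 ≤ 16E(W)`; the term `DN²|W|³/T³ ≤ 2N^{-4/5}|W|³`).
[cite: GuthMaynard2026, Lemma 11.8 and (11.23)] -/
theorem small_part {η : ℝ} (hη : 0 < η) :
    ∃ C, 0 ≤ C ∧ ∀ (N : ℕ), 1 ≤ N → ∀ (t₀ : ℝ) (W : Finset ℝ),
      (∀ t ∈ W, t₀ ≤ t ∧ t ≤ t₀ + (N : ℝ) ^ (6 / 5 : ℝ)) →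
      (∀ t ∈ W, ∀ t' ∈ W, t ≠ t' → 1 ≤ |t - t'|) → 1 ≤ W.card →
      ∑ d ∈ Finset.Icc 1 ⌈(N : ℝ) ^ (4 / 5 : ℝ)⌉₊, ∑ p ∈ gcdPairs N d, ‖Rfun W ((p.1 : ℝ) / p.2)‖ ^ 3 ≤
        C * (N : ℝ) ^ η * ((N : ℝ) ^ 2 * (W.card : ℝ) ^ (1 / 2 : ℝ) * ((((W ×ˢ W) ×ˢ (W ×ˢ W)).filter
            (fun q : (ℝ × ℝ) × (ℝ × ℝ) ↦ |q.1.1 + q.1.2 - q.2.1 - q.2.2| ≤ 1)).card : ℝ) ^ (1 / 2 : ℝ)) +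
        C * ((N : ℝ) * (W.card : ℝ) ^ 3) := by
  set j : ℕ := ⌈5 / η⌉₊ + 1 with hj
  have hjη : 5 ≤ η * ((j : ℝ) - 1) := by
    have h1 : ((j : ℝ) - 1) = (⌈5 / η⌉₊ : ℝ) := by rw [hj]; push_cast; ring
    have h2 : 5 / η ≤ (⌈5 / η⌉₊ : ℝ) := Nat.le_ceil _
    rw [h1]
    calc (5 : ℝ) = η * (5 / η) := by field_simp
      _ ≤ η * (⌈5 / η⌉₊ : ℝ) := by gcongr
  obtain ⟨C₁, hC₁0, hC₁⟩ := small_gcd_third_moment j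
  refine ⟨15 * C₁, by positivity, fun N hN t₀ W hW hsep hWpos ↦ ?_⟩
  have hn1 : (1 : ℝ) ≤ N := by exact_mod_cast hN
  have hn0 : (0 : ℝ) < N := by linarith
  have hnle : ∀ {x y : ℝ}, x ≤ y → (N : ℝ) ^ x ≤ (N : ℝ) ^ y :=
    fun h ↦ Real.rpow_le_rpow_of_exponent_le hn1 h
  have hnp : ∀ x y : ℝ, (N : ℝ) ^ x * (N : ℝ) ^ y = (N : ℝ) ^ (x + y) :=
    fun x y ↦ (Real.rpow_add hn0 x y).symm
  have hn1le : ∀ {x : ℝ}, 0 ≤ x → 1 ≤ (N : ℝ) ^ x := fun h ↦ Real.one_le_rpow hn1 h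
  set T : ℝ := (N : ℝ) ^ (6 / 5 : ℝ) with hT
  have hT1 : 1 ≤ T := hn1le (by norm_num)
  have hT0 : 0 < T := by linarith
  have hT3 : T ^ 3 = (N : ℝ) ^ (18 / 5 : ℝ) := by
    rw [hT, ← Real.rpow_natCast, ← Real.rpow_mul hn0.le]; norm_num
  have hT4 : T ^ 4 = (N : ℝ) ^ (24 / 5 : ℝ) := by
    rw [hT, ← Real.rpow_natCast, ← Real.rpow_mul hn0.le]; norm_num
  set K : ℝ := (W.card : ℝ) with hK
  have hK0 : 0 ≤ K := Nat.cast_nonneg _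
  have hK1 : 1 ≤ K := by rw [hK]; exact_mod_cast hWpos
  set E₁ : ℝ := ((((W ×ˢ W) ×ˢ (W ×ˢ W)).filter
    (fun q : (ℝ × ℝ) × (ℝ × ℝ) ↦ |q.1.1 + q.1.2 - q.2.1 - q.2.2| ≤ 1)).card : ℝ) with hE₁
  have hE₁0 : 0 ≤ E₁ := Nat.cast_nonneg _
  have hKE : K ^ 2 ≤ E₁ := card_sq_le_energy W
  have hE₁1 : 1 ≤ E₁ := le_trans (by nlinarith) hKE
  have hKT : K ≤ 2 * T := card_le_two_mul hN hW hsep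
  -- `D`
  set D : ℕ := ⌈(N : ℝ) ^ (4 / 5 : ℝ)⌉₊ with hD
  have hn45 : 1 ≤ (N : ℝ) ^ (4 / 5 : ℝ) := hn1le (by norm_num)
  have hD1 : 1 ≤ D := Nat.ceil_pos.mpr (by linarith)
  have hDle : (D : ℝ) ≤ 2 * (N : ℝ) ^ (4 / 5 : ℝ) := by
    have := Nat.ceil_lt_add_one (by linarith : (0 : ℝ) ≤ (N : ℝ) ^ (4 / 5 : ℝ))
    rw [← hD] at this
    linarith
  -- Lemma 11.8
  set Dl : ℝ := (N : ℝ) ^ η with hDl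
  have hDl1 : 1 ≤ Dl := hn1le hη.le
  have h1 : ∑ d ∈ Finset.Icc 1 D, ∑ p ∈ gcdPairs N d, ‖Rfun W ((p.1 : ℝ) / p.2)‖ ^ 3 ≤
      C₁ * ((D : ℝ) * T + (N : ℝ) ^ 2) * K ^ (1 / 2 : ℝ) * (Dl * E₁ + Dl / Dl ^ j * K ^ 4) ^ (1 / 2 : ℝ) +
        C₁ * D * (N : ℝ) ^ 2 * K ^ 3 / T ^ 3 :=
    hC₁ N D hN hD1 T t₀ Dl hT1 hDl1 W hW hsep
  have hDT : (D : ℝ) * T + (N : ℝ) ^ 2 ≤ 3 * (N : ℝ) ^ 2 := by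
    have e1 : (N : ℝ) ^ (4 / 5 : ℝ) * T = (N : ℝ) ^ 2 := by
      rw [hT, hnp, show (N : ℝ) ^ 2 = (N : ℝ) ^ (2 : ℝ) by norm_cast]; norm_num
    have : (D : ℝ) * T ≤ 2 * (N : ℝ) ^ (4 / 5 : ℝ) * T := mul_le_mul_of_nonneg_right hDle hT0.le
    linarith
  have htail : Dl / Dl ^ j * K ^ 4 ≤ 16 * E₁ := by
    have e1 : Dl / Dl ^ j = (N : ℝ) ^ (η - η * j) := by
      rw [hDl, ← Real.rpow_natCast, ← Real.rpow_mul hn0.le, ← Real.rpow_sub hn0]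
    have h3 : (N : ℝ) ^ (η - η * j) ≤ (N : ℝ) ^ (-(24 / 5) : ℝ) := hnle (by linarith)
    have h4 : K ^ 4 ≤ 16 * (N : ℝ) ^ (24 / 5 : ℝ) := by
      calc K ^ 4 ≤ (2 * T) ^ 4 := pow_le_pow_left₀ hK0 hKT 4
        _ = 16 * (N : ℝ) ^ (24 / 5 : ℝ) := by rw [mul_pow, hT4]; norm_num
    have h5 : (N : ℝ) ^ (-(24 / 5) : ℝ) * (N : ℝ) ^ (24 / 5 : ℝ) = 1 := by rw [hnp]; norm_num
    calc Dl / Dl ^ j * K ^ 4 ≤ (N : ℝ) ^ (-(24 / 5) : ℝ) * (16 * (N : ℝ) ^ (24 / 5 : ℝ)) := by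
          rw [e1]; exact mul_le_mul h3 h4 (by positivity) (by positivity)
      _ = 16 * ((N : ℝ) ^ (-(24 / 5) : ℝ) * (N : ℝ) ^ (24 / 5 : ℝ)) := by ring
      _ = 16 := by rw [h5, mul_one]
      _ ≤ 16 * E₁ := by linarith
  have hroot : (Dl * E₁ + Dl / Dl ^ j * K ^ 4) ^ (1 / 2 : ℝ) ≤ 5 * (N : ℝ) ^ η * E₁ ^ (1 / 2 : ℝ) := by
    have h2 : Dl * E₁ + Dl / Dl ^ j * K ^ 4 ≤ 25 * ((N : ℝ) ^ η) ^ 2 * E₁ := by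
      have h6 : (N : ℝ) ^ η ≤ ((N : ℝ) ^ η) ^ 2 := by
        have : 1 ≤ (N : ℝ) ^ η := hDl1
        nlinarith
      have h7 : (1 : ℝ) ≤ ((N : ℝ) ^ η) ^ 2 := le_trans hDl1 h6
      have h8 : Dl * E₁ ≤ ((N : ℝ) ^ η) ^ 2 * E₁ := mul_le_mul_of_nonneg_right h6 hE₁0
      have h9 : 16 * E₁ ≤ 16 * ((N : ℝ) ^ η) ^ 2 * E₁ := by nlinarith
      linarith
    calc (Dl * E₁ + Dl / Dl ^ j * K ^ 4) ^ (1 / 2 : ℝ) ≤ (25 * ((N : ℝ) ^ η) ^ 2 * E₁) ^ (1 / 2 : ℝ) :=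
          Real.rpow_le_rpow (by positivity) h2 (by norm_num)
      _ = ((5 * (N : ℝ) ^ η) ^ 2) ^ (1 / 2 : ℝ) * E₁ ^ (1 / 2 : ℝ) := by
          rw [← Real.mul_rpow (by positivity) hE₁0]; ring_nf
      _ = 5 * (N : ℝ) ^ η * E₁ ^ (1 / 2 : ℝ) := by
          rw [← Real.sqrt_eq_rpow ((5 * (N : ℝ) ^ η) ^ 2), Real.sqrt_sq (by positivity)]
  have hterm2 : C₁ * D * (N : ℝ) ^ 2 * K ^ 3 / T ^ 3 ≤ 2 * C₁ * ((N : ℝ) * K ^ 3) := by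
    rw [div_le_iff₀ (by positivity), hT3]
    have h2 : (D : ℝ) * (N : ℝ) ^ 2 ≤ 2 * ((N : ℝ) * (N : ℝ) ^ (18 / 5 : ℝ)) := by
      calc (D : ℝ) * (N : ℝ) ^ 2 ≤ 2 * (N : ℝ) ^ (4 / 5 : ℝ) * (N : ℝ) ^ 2 :=
            mul_le_mul_of_nonneg_right hDle (by positivity)
        _ = 2 * (N : ℝ) ^ (14 / 5 : ℝ) := by
            rw [show (N : ℝ) ^ 2 = (N : ℝ) ^ (2 : ℝ) by norm_cast, mul_assoc, hnp]; norm_num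
        _ ≤ 2 * (N : ℝ) ^ (23 / 5 : ℝ) := by
            have := hnle (show (14 / 5 : ℝ) ≤ 23 / 5 by norm_num); linarith
        _ = 2 * ((N : ℝ) * (N : ℝ) ^ (18 / 5 : ℝ)) := by
            rw [show (N : ℝ) * (N : ℝ) ^ (18 / 5 : ℝ) = (N : ℝ) ^ (1 : ℝ) * (N : ℝ) ^ (18 / 5 : ℝ) by
              rw [Real.rpow_one], hnp]
            norm_num
    calc C₁ * D * (N : ℝ) ^ 2 * K ^ 3 = C₁ * K ^ 3 * ((D : ℝ) * (N : ℝ) ^ 2) := by ring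
      _ ≤ C₁ * K ^ 3 * (2 * ((N : ℝ) * (N : ℝ) ^ (18 / 5 : ℝ))) :=
          mul_le_mul_of_nonneg_left h2 (by positivity)
      _ = 2 * C₁ * ((N : ℝ) * K ^ 3) * (N : ℝ) ^ (18 / 5 : ℝ) := by ring
  have hterm1 : C₁ * ((D : ℝ) * T + (N : ℝ) ^ 2) * K ^ (1 / 2 : ℝ) * (Dl * E₁ + Dl / Dl ^ j * K ^ 4) ^ (1 / 2 : ℝ)
      ≤ 15 * C₁ * (N : ℝ) ^ η * ((N : ℝ) ^ 2 * K ^ (1 / 2 : ℝ) * E₁ ^ (1 / 2 : ℝ)) := by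
    calc C₁ * ((D : ℝ) * T + (N : ℝ) ^ 2) * K ^ (1 / 2 : ℝ) * (Dl * E₁ + Dl / Dl ^ j * K ^ 4) ^ (1 / 2 : ℝ)
        ≤ C₁ * (3 * (N : ℝ) ^ 2) * K ^ (1 / 2 : ℝ) * (5 * (N : ℝ) ^ η * E₁ ^ (1 / 2 : ℝ)) := by
          gcongr
      _ = 15 * C₁ * (N : ℝ) ^ η * ((N : ℝ) ^ 2 * K ^ (1 / 2 : ℝ) * E₁ ^ (1 / 2 : ℝ)) := by ring
  have hterm2' : 2 * C₁ * ((N : ℝ) * K ^ 3) ≤ 15 * C₁ * ((N : ℝ) * K ^ 3) := by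
    have : 0 ≤ C₁ * ((N : ℝ) * K ^ 3) := by positivity
    linarith
  linarith [h1, hterm1, hterm2, hterm2']

set_option maxHeartbeats 1600000 in
/-- **The large-gcd part of `∑|R|³` in the setting of Proposition 11.1** (Lemma 11.9 of the paper
for `T = N^{6/5}`, `D = ⌈N^{4/5}⌉`): for `0 < η ≤ 1` there is `C` with
`∑_{D<d≤2N} ∑_{gcd=d} |R|³ ≤ C N^{3η} (5N|W|³ + 2|W|^{21/8}N^{13/10} + 4N²|W|^{1/2}E(W)^{1/2})` for
`N ≥ 1` and finite non-empty `1`-separated `W` in an interval of length `N^{6/5}`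
(`large_gcd_third_moment`, `N²/D ≤ N^{6/5} = T`, `1 + log 2N ≪ N^η`, `large_gcd_algebra`).
[cite: GuthMaynard2026, Lemma 11.9] -/
theorem large_part {η : ℝ} (hη : 0 < η) (hη1 : η ≤ 1) :
    ∃ C, 0 ≤ C ∧ ∀ (N : ℕ), 1 ≤ N → ∀ (t₀ : ℝ) (W : Finset ℝ),
      (∀ t ∈ W, t₀ ≤ t ∧ t ≤ t₀ + (N : ℝ) ^ (6 / 5 : ℝ)) →
      (∀ t ∈ W, ∀ t' ∈ W, t ≠ t' → 1 ≤ |t - t'|) → 1 ≤ W.card →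
      ∑ d ∈ Finset.Ioc ⌈(N : ℝ) ^ (4 / 5 : ℝ)⌉₊ (2 * N), ∑ p ∈ gcdPairs N d, ‖Rfun W ((p.1 : ℝ) / p.2)‖ ^ 3 ≤
        C * (N : ℝ) ^ (3 * η) * (5 * ((N : ℝ) * (W.card : ℝ) ^ 3) +
          2 * ((W.card : ℝ) ^ (21 / 8 : ℝ) * (N : ℝ) ^ (13 / 10 : ℝ)) +
          4 * ((N : ℝ) ^ 2 * (W.card : ℝ) ^ (1 / 2 : ℝ) * ((((W ×ˢ W) ×ˢ (W ×ˢ W)).filter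
            (fun q : (ℝ × ℝ) × (ℝ × ℝ) ↦ |q.1.1 + q.1.2 - q.2.1 - q.2.2| ≤ 1)).card : ℝ) ^ (1 / 2 : ℝ))) := by
  obtain ⟨C₅, hC₅0, hC₅⟩ := large_gcd_third_moment hη
  set Cl : ℝ := 1 + 2 / η with hCl
  have hCl0 : 0 ≤ Cl := by positivity
  refine ⟨C₅ * Cl, by positivity, fun N hN t₀ W hW hsep hWpos ↦ ?_⟩
  have hn1 : (1 : ℝ) ≤ N := by exact_mod_cast hN
  have hn0 : (0 : ℝ) < N := by linarith
  have hnle : ∀ {x y : ℝ}, x ≤ y → (N : ℝ) ^ x ≤ (N : ℝ) ^ y :=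
    fun h ↦ Real.rpow_le_rpow_of_exponent_le hn1 h
  have hnp : ∀ x y : ℝ, (N : ℝ) ^ x * (N : ℝ) ^ y = (N : ℝ) ^ (x + y) :=
    fun x y ↦ (Real.rpow_add hn0 x y).symm
  have hn1le : ∀ {x : ℝ}, 0 ≤ x → 1 ≤ (N : ℝ) ^ x := fun h ↦ Real.one_le_rpow hn1 h
  set T : ℝ := (N : ℝ) ^ (6 / 5 : ℝ) with hT
  have hT1 : 1 ≤ T := hn1le (by norm_num)
  have hT0 : 0 < T := by linarith
  have hT12 : T ^ (1 / 2 : ℝ) = (N : ℝ) ^ (3 / 5 : ℝ) := by rw [hT, ← Real.rpow_mul hn0.le]; norm_num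
  have hTη : T ^ η ≤ (N : ℝ) ^ (2 * η) := by
    rw [hT, ← Real.rpow_mul hn0.le]; exact hnle (by nlinarith)
  set K : ℝ := (W.card : ℝ) with hK
  have hK0 : 0 ≤ K := Nat.cast_nonneg _
  have hK1 : 1 ≤ K := by rw [hK]; exact_mod_cast hWpos
  set E₁ : ℝ := ((((W ×ˢ W) ×ˢ (W ×ˢ W)).filter
    (fun q : (ℝ × ℝ) × (ℝ × ℝ) ↦ |q.1.1 + q.1.2 - q.2.1 - q.2.2| ≤ 1)).card : ℝ) with hE₁
  have hE₁0 : 0 ≤ E₁ := Nat.cast_nonneg _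
  have hKE : K ^ 2 ≤ E₁ := card_sq_le_energy W
  have hE3 : E₁ ≤ 3 * K ^ 3 := energy_le_three_mul_card_cube W hsep
  -- `D`
  set D : ℕ := ⌈(N : ℝ) ^ (4 / 5 : ℝ)⌉₊ with hD
  have hn45 : 1 ≤ (N : ℝ) ^ (4 / 5 : ℝ) := hn1le (by norm_num)
  have hD1 : 1 ≤ D := Nat.ceil_pos.mpr (by linarith)
  have hDr0 : (0 : ℝ) < D := by exact_mod_cast hD1
  have hDge : (N : ℝ) ^ (4 / 5 : ℝ) ≤ D := Nat.le_ceil _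
  -- Lemma 11.9 (before the case analysis)
  set A : ℝ := K ^ 2 * N + K * (N : ℝ) ^ 2 / D + K ^ (5 / 4 : ℝ) * T ^ (1 / 2 : ℝ) * N with hA
  set B : ℝ := K ^ 4 * N + (N : ℝ) ^ 2 / D * E₁ + E₁ ^ (3 / 4 : ℝ) * K * T ^ (1 / 2 : ℝ) * N with hB
  have hA0 : 0 ≤ A := by positivity
  have hB0 : 0 ≤ B := by positivity
  have h1 : ∑ d ∈ Finset.Ioc D (2 * N), ∑ p ∈ gcdPairs N d, ‖Rfun W ((p.1 : ℝ) / p.2)‖ ^ 3 ≤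
      C₅ * T ^ η * (1 + Real.log ((2 * N : ℕ) : ℝ)) * A ^ (1 / 2 : ℝ) * B ^ (1 / 2 : ℝ) :=
    hC₅ N D hN hD1 T t₀ hT1 W hW hsep
  -- `A ≤ A₀`, `B ≤ B₀`
  set A₀ : ℝ := K ^ 2 * N + K * (N : ℝ) ^ (6 / 5 : ℝ) + K ^ (5 / 4 : ℝ) * (N : ℝ) ^ (8 / 5 : ℝ) with hA₀
  set B₀ : ℝ := K ^ 4 * N + (N : ℝ) ^ (6 / 5 : ℝ) * E₁ + E₁ ^ (3 / 4 : ℝ) * K * (N : ℝ) ^ (8 / 5 : ℝ) with hB₀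
  have hn2D : (N : ℝ) ^ 2 / D ≤ (N : ℝ) ^ (6 / 5 : ℝ) := by
    rw [div_le_iff₀ hDr0]
    calc (N : ℝ) ^ 2 = (N : ℝ) ^ (6 / 5 : ℝ) * (N : ℝ) ^ (4 / 5 : ℝ) := by
          rw [hnp, show (N : ℝ) ^ 2 = (N : ℝ) ^ (2 : ℝ) by norm_cast]; norm_num
      _ ≤ (N : ℝ) ^ (6 / 5 : ℝ) * D := mul_le_mul_of_nonneg_left hDge (by positivity)
  have hn85 : T ^ (1 / 2 : ℝ) * N = (N : ℝ) ^ (8 / 5 : ℝ) := by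
    rw [hT12, show (N : ℝ) ^ (3 / 5 : ℝ) * N = (N : ℝ) ^ (3 / 5 : ℝ) * (N : ℝ) ^ (1 : ℝ) by
      rw [Real.rpow_one], hnp]
    norm_num
  have hAA₀ : A ≤ A₀ := by
    have h2 : K * (N : ℝ) ^ 2 / D ≤ K * (N : ℝ) ^ (6 / 5 : ℝ) := by
      rw [mul_div_assoc]; exact mul_le_mul_of_nonneg_left hn2D hK0
    have h3 : K ^ (5 / 4 : ℝ) * T ^ (1 / 2 : ℝ) * N = K ^ (5 / 4 : ℝ) * (N : ℝ) ^ (8 / 5 : ℝ) := by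
      rw [mul_assoc, hn85]
    rw [hA, hA₀, h3]; linarith
  have hBB₀ : B ≤ B₀ := by
    have h2 : (N : ℝ) ^ 2 / D * E₁ ≤ (N : ℝ) ^ (6 / 5 : ℝ) * E₁ := mul_le_mul_of_nonneg_right hn2D hE₁0
    have h3 : E₁ ^ (3 / 4 : ℝ) * K * T ^ (1 / 2 : ℝ) * N = E₁ ^ (3 / 4 : ℝ) * K * (N : ℝ) ^ (8 / 5 : ℝ) := by
      rw [mul_assoc, hn85]
    rw [hB, hB₀, h3]; linarith
  have halg : A₀ ^ (1 / 2 : ℝ) * B₀ ^ (1 / 2 : ℝ) ≤ 5 * K ^ 3 * N + 2 * K ^ (21 / 8 : ℝ) * (N : ℝ) ^ (13 / 10 : ℝ) +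
      4 * E₁ ^ (1 / 2 : ℝ) * K ^ (1 / 2 : ℝ) * (N : ℝ) ^ 2 := large_gcd_algebra hn1 hK1 hKE hE3
  have hAB : A ^ (1 / 2 : ℝ) * B ^ (1 / 2 : ℝ) ≤ 5 * K ^ 3 * N + 2 * K ^ (21 / 8 : ℝ) * (N : ℝ) ^ (13 / 10 : ℝ) +
      4 * E₁ ^ (1 / 2 : ℝ) * K ^ (1 / 2 : ℝ) * (N : ℝ) ^ 2 := by
    refine le_trans ?_ halg
    exact mul_le_mul (Real.rpow_le_rpow hA0 hAA₀ (by norm_num)) (Real.rpow_le_rpow hB0 hBB₀ (by norm_num))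
      (Real.rpow_nonneg hB0 _) (Real.rpow_nonneg (hA0.trans hAA₀) _)
  -- `T^η (1 + log 2N) ≤ Cl N^{3η}`
  have hL : 1 + Real.log ((2 * N : ℕ) : ℝ) ≤ Cl * (N : ℝ) ^ η := by
    have : ((2 * N : ℕ) : ℝ) = 2 * (N : ℝ) := by push_cast; ring
    rw [this]
    exact one_add_log_le hη hη1 hn1
  have hL0 : 0 ≤ 1 + Real.log ((2 * N : ℕ) : ℝ) := by
    have : 0 ≤ Real.log ((2 * N : ℕ) : ℝ) :=
      Real.log_nonneg (by exact_mod_cast (show 1 ≤ 2 * N by omega))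
    linarith
  have hTL : T ^ η * (1 + Real.log ((2 * N : ℕ) : ℝ)) ≤ Cl * (N : ℝ) ^ (3 * η) := by
    calc T ^ η * (1 + Real.log ((2 * N : ℕ) : ℝ)) ≤ (N : ℝ) ^ (2 * η) * (Cl * (N : ℝ) ^ η) :=
          mul_le_mul hTη hL hL0 (by positivity)
      _ = Cl * ((N : ℝ) ^ (2 * η) * (N : ℝ) ^ η) := by ring
      _ = Cl * (N : ℝ) ^ (3 * η) := by rw [hnp]; ring_nf
  have hfin0 : 0 ≤ 5 * K ^ 3 * N + 2 * K ^ (21 / 8 : ℝ) * (N : ℝ) ^ (13 / 10 : ℝ) +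
      4 * E₁ ^ (1 / 2 : ℝ) * K ^ (1 / 2 : ℝ) * (N : ℝ) ^ 2 := by positivity
  calc ∑ d ∈ Finset.Ioc D (2 * N), ∑ p ∈ gcdPairs N d, ‖Rfun W ((p.1 : ℝ) / p.2)‖ ^ 3
      ≤ C₅ * T ^ η * (1 + Real.log ((2 * N : ℕ) : ℝ)) * A ^ (1 / 2 : ℝ) * B ^ (1 / 2 : ℝ) := h1
    _ = C₅ * (T ^ η * (1 + Real.log ((2 * N : ℕ) : ℝ))) * (A ^ (1 / 2 : ℝ) * B ^ (1 / 2 : ℝ)) := by ring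
    _ ≤ C₅ * (Cl * (N : ℝ) ^ (3 * η)) * (5 * K ^ 3 * N + 2 * K ^ (21 / 8 : ℝ) * (N : ℝ) ^ (13 / 10 : ℝ) +
        4 * E₁ ^ (1 / 2 : ℝ) * K ^ (1 / 2 : ℝ) * (N : ℝ) ^ 2) :=
        mul_le_mul (mul_le_mul_of_nonneg_left hTL hC₅0) hAB (by positivity) (by positivity)
    _ = _ := by ring

set_option maxHeartbeats 1600000 in
/-- **The final algebra of §11**: if `E ≤ C₀ N^{-2σ} S` and
`S ≤ C₆ N^{3η} (N²K^{1/2}E^{1/2} + NK³ + K^{21/8}N^{13/10})` with `6η ≤ δ`, `N ≥ 1`, then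
`E ≤ (2C₀C₆ + (C₀C₆)²) N^δ (K N^{4−4σ} + K^{21/8}(N^{6/5})^{1/4}N^{1−2σ} + K³N^{1−2σ})`
("This rearranges to give …"). [cite: GuthMaynard2026, proof of Proposition 11.1] -/
theorem final_algebra {n K E S C₀ C₆ σ η δ : ℝ} (hn : 1 ≤ n) (hK : 0 ≤ K) (hE : 0 ≤ E) (hC₀ : 0 ≤ C₀)
    (hC₆ : 0 ≤ C₆) (hη : 0 ≤ η) (hηδ : 6 * η ≤ δ)
    (h1 : E ≤ C₀ * n ^ (-2 * σ) * S)
    (h2 : S ≤ C₆ * n ^ (3 * η) * (n ^ 2 * K ^ (1 / 2 : ℝ) * E ^ (1 / 2 : ℝ) + n * K ^ 3 +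
      K ^ (21 / 8 : ℝ) * n ^ (13 / 10 : ℝ))) :
    E ≤ (2 * (C₀ * C₆) + (C₀ * C₆) ^ 2) * n ^ δ * (K * n ^ (4 - 4 * σ) +
      K ^ (21 / 8 : ℝ) * (n ^ (6 / 5 : ℝ)) ^ (1 / 4 : ℝ) * n ^ (1 - 2 * σ) + K ^ 3 * n ^ (1 - 2 * σ)) := by
  have hn0 : 0 < n := by linarith
  have hnle : ∀ {x y : ℝ}, x ≤ y → n ^ x ≤ n ^ y := fun h ↦ Real.rpow_le_rpow_of_exponent_le hn h
  have hnp : ∀ x y : ℝ, n ^ x * n ^ y = n ^ (x + y) := fun x y ↦ (Real.rpow_add hn0 x y).symm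
  have hσpow : n ^ (-2 * σ) * n ^ 2 = n ^ (2 - 2 * σ) := by
    rw [show n ^ 2 = n ^ (2 : ℝ) by norm_cast, hnp]; ring_nf
  have hσpow1 : n ^ (-2 * σ) * n = n ^ (1 - 2 * σ) := by
    rw [show n ^ (-2 * σ) * n = n ^ (-2 * σ) * n ^ (1 : ℝ) by rw [Real.rpow_one], hnp]; ring_nf
  have hσpow2 : n ^ (-2 * σ) * n ^ (13 / 10 : ℝ) = (n ^ (6 / 5 : ℝ)) ^ (1 / 4 : ℝ) * n ^ (1 - 2 * σ) := by
    rw [← Real.rpow_mul hn0.le, hnp, hnp]; ring_nf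
  set Y : ℝ := C₀ * C₆ * n ^ (3 * η) * n ^ (2 - 2 * σ) * K ^ (1 / 2 : ℝ) with hY
  set X : ℝ := C₀ * C₆ * n ^ (3 * η) * (K ^ 3 * n ^ (1 - 2 * σ) +
    K ^ (21 / 8 : ℝ) * (n ^ (6 / 5 : ℝ)) ^ (1 / 4 : ℝ) * n ^ (1 - 2 * σ)) with hX
  have hEXY : E ≤ X + Y * E ^ (1 / 2 : ℝ) := by
    calc E ≤ C₀ * n ^ (-2 * σ) * S := h1
      _ ≤ C₀ * n ^ (-2 * σ) * (C₆ * n ^ (3 * η) * (n ^ 2 * K ^ (1 / 2 : ℝ) * E ^ (1 / 2 : ℝ) + n * K ^ 3 +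
          K ^ (21 / 8 : ℝ) * n ^ (13 / 10 : ℝ))) := mul_le_mul_of_nonneg_left h2 (by positivity)
      _ = X + Y * E ^ (1 / 2 : ℝ) := by
          rw [hX, hY]
          linear_combination (C₀ * C₆ * n ^ (3 * η) * K ^ (1 / 2 : ℝ) * E ^ (1 / 2 : ℝ)) * hσpow +
            (C₀ * C₆ * n ^ (3 * η) * K ^ 3) * hσpow1 + (C₀ * C₆ * n ^ (3 * η) * K ^ (21 / 8 : ℝ)) * hσpow2
  have hEfin : E ≤ 2 * X + Y ^ 2 := le_of_sqrt_bound hE hEXY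
  have hnδ1 : n ^ (3 * η) ≤ n ^ δ := hnle (by linarith)
  have hnδ2 : n ^ (3 * η) * n ^ (3 * η) ≤ n ^ δ := by rw [hnp]; exact hnle (by linarith)
  have hY2 : Y ^ 2 = (C₀ * C₆) ^ 2 * (n ^ (3 * η) * n ^ (3 * η)) * (K * n ^ (4 - 4 * σ)) := by
    have e1 : (n ^ (2 - 2 * σ)) ^ 2 = n ^ (4 - 4 * σ) := by
      rw [← Real.rpow_natCast, ← Real.rpow_mul hn0.le]; ring_nf
    have e2 : (K ^ (1 / 2 : ℝ)) ^ 2 = K := by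
      rw [← Real.rpow_natCast, ← Real.rpow_mul hK]; norm_num
    rw [hY, mul_pow, mul_pow, mul_pow, mul_pow, e1, e2]; ring
  set V : ℝ := K * n ^ (4 - 4 * σ) with hV
  set Z : ℝ := K ^ 3 * n ^ (1 - 2 * σ) + K ^ (21 / 8 : ℝ) * (n ^ (6 / 5 : ℝ)) ^ (1 / 4 : ℝ) * n ^ (1 - 2 * σ)
    with hZ
  have hV0 : 0 ≤ V := by positivity
  have hZ0 : 0 ≤ Z := by positivity
  have h2X : 2 * X ≤ 2 * (C₀ * C₆) * n ^ δ * Z := by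
    have : C₀ * C₆ * n ^ (3 * η) * Z ≤ C₀ * C₆ * n ^ δ * Z := by gcongr
    rw [hX]; linarith
  have hY2le : Y ^ 2 ≤ (C₀ * C₆) ^ 2 * n ^ δ * V := by
    rw [hY2]; gcongr
  have hc1 : 0 ≤ 2 * (C₀ * C₆) * n ^ δ := by positivity
  have hc2 : 0 ≤ (C₀ * C₆) ^ 2 * n ^ δ := by positivity
  calc E ≤ 2 * X + Y ^ 2 := hEfin
    _ ≤ 2 * (C₀ * C₆) * n ^ δ * Z + (C₀ * C₆) ^ 2 * n ^ δ * V := add_le_add h2X hY2le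
    _ ≤ 2 * (C₀ * C₆) * n ^ δ * (V + Z) + (C₀ * C₆) ^ 2 * n ^ δ * (V + Z) := by
        nlinarith [mul_nonneg hc1 hV0, mul_nonneg hc2 hZ0]
    _ = _ := by rw [hV, hZ]; ring

set_option maxHeartbeats 1600000 in
/-- **Guth–Maynard Proposition 11.1 (Bound for energy), for `T = N^{6/5}`**, in exactly the form
`hE` of `GuthMaynardAssembly.zeroDensity_guth_maynard_of_bounds`: for `σ ∈ [7/10, 4/5]` and `δ > 0`
there are `C, N₀` such that for `N ≥ N₀`, `1`-bounded `a_n`, and a finite `1`-separated `W` in an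
interval of length `T = N^{6/5}` with `|∑_{N≤n≤2N} a_n n^{it}| ≥ N^σ` on `W`,
`E(W) ≤ C N^δ (|W|N^{4−4σ} + |W|^{21/8}T^{1/4}N^{1−2σ} + |W|³N^{1−2σ})`.
Proof as printed: Lemma 11.4; split `∑_{n₁,n₂}|R(n₁/n₂)|³` at `gcd = D = ⌈N²/T⌉`; Lemma 11.8 for
`gcd ≤ D` (`small_part`) and Lemma 11.9 for `gcd > D` (`large_part`); rearrange (`final_algebra`).
(Here `N = T^{5/6} ≥ T^{3/4}` automatically; the hypotheses on `σ` are not used.)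
[cite: GuthMaynard2026, Proposition 11.1] -/
theorem energy_bound : ∀ σ : ℝ, 7 / 10 ≤ σ → σ ≤ 4 / 5 → ∀ δ : ℝ, 0 < δ → ∃ C N₀ : ℝ, ∀ N : ℕ, N₀ ≤ (N : ℝ) →
      ∀ (a : ℕ → ℂ) (t₀ : ℝ) (W : Finset ℝ), (∀ n, ‖a n‖ ≤ 1) →
      (∀ t ∈ W, t₀ ≤ t ∧ t ≤ t₀ + (N : ℝ) ^ (6 / 5 : ℝ)) →
      (∀ t ∈ W, ∀ t' ∈ W, t ≠ t' → 1 ≤ |t - t'|) →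
      (∀ t ∈ W, (N : ℝ) ^ σ ≤ ‖∑ n ∈ Finset.Icc N (2 * N), a n * (n : ℂ) ^ ((t : ℂ) * I)‖) →
      GuthMaynardAssembly.addEnergy W ≤ C * (N : ℝ) ^ δ * ((W.card : ℝ) * (N : ℝ) ^ (4 - 4 * σ) +
        (W.card : ℝ) ^ (21 / 8 : ℝ) * ((N : ℝ) ^ (6 / 5 : ℝ)) ^ (1 / 4 : ℝ) * (N : ℝ) ^ (1 - 2 * σ) +
        (W.card : ℝ) ^ 3 * (N : ℝ) ^ (1 - 2 * σ)) := by
  intro σ _ _ δ hδ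
  -- `η = min(δ,1)/8`
  set m : ℝ := min δ 1 with hm
  have hm0 : 0 < m := lt_min hδ one_pos
  have hm1 : m ≤ 1 := min_le_right _ _
  have hmδ : m ≤ δ := min_le_left _ _
  set η : ℝ := m / 8 with hη
  have hη0 : 0 < η := by positivity
  have hη1 : η ≤ 1 := by rw [hη]; linarith
  have hηδ : 6 * η ≤ δ := by rw [hη]; linarith
  obtain ⟨C₀, hC₀0, hC₀⟩ := energy_le_third_moment_abs
  obtain ⟨Cs, hCs0, hCs⟩ := small_part hη0
  obtain ⟨Cg, hCg0, hCg⟩ := large_part hη0 hη1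
  set C₆ : ℝ := Cs + 5 * Cg with hC₆
  have hC₆0 : 0 ≤ C₆ := by positivity
  refine ⟨2 * (C₀ * C₆) + (C₀ * C₆) ^ 2, 1, fun N hN a t₀ W ha hW hsep hlarge ↦ ?_⟩
  classical
  have hN1 : 1 ≤ N := by exact_mod_cast hN
  have hn1 : (1 : ℝ) ≤ N := hN
  have hn0 : (0 : ℝ) < N := by linarith
  set K : ℝ := (W.card : ℝ) with hK
  have hK0 : 0 ≤ K := Nat.cast_nonneg _
  set E₁ : ℝ := ((((W ×ˢ W) ×ˢ (W ×ˢ W)).filter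
    (fun q : (ℝ × ℝ) × (ℝ × ℝ) ↦ |q.1.1 + q.1.2 - q.2.1 - q.2.2| ≤ 1)).card : ℝ) with hE₁
  have hE₁0 : 0 ≤ E₁ := Nat.cast_nonneg _
  have hEdef : GuthMaynardAssembly.addEnergy W = E₁ := rfl
  rw [hEdef]
  have hRHS0 : 0 ≤ (2 * (C₀ * C₆) + (C₀ * C₆) ^ 2) * (N : ℝ) ^ δ * (K * (N : ℝ) ^ (4 - 4 * σ) +
      K ^ (21 / 8 : ℝ) * ((N : ℝ) ^ (6 / 5 : ℝ)) ^ (1 / 4 : ℝ) * (N : ℝ) ^ (1 - 2 * σ) +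
      K ^ 3 * (N : ℝ) ^ (1 - 2 * σ)) := by positivity
  -- the empty case
  rcases Nat.eq_zero_or_pos W.card with hW0 | hWpos
  · have hE3 : E₁ ≤ 3 * K ^ 3 := energy_le_three_mul_card_cube W hsep
    have hK00 : K = 0 := by rw [hK, hW0, Nat.cast_zero]
    rw [hK00] at hE3
    linarith
  have hWpos' : 1 ≤ W.card := hWpos
  -- Step 1: Lemma 11.4
  set S₃ : ℝ := ∑ n₁ ∈ Finset.Icc N (2 * N), ∑ n₂ ∈ Finset.Icc N (2 * N),
    ‖Rfun W ((n₁ : ℝ) / n₂)‖ ^ 3 with hS₃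
  have h114 : E₁ ≤ C₀ * (N : ℝ) ^ (-2 * σ) * S₃ := hC₀ N hN1 σ a W ha hsep hlarge
  -- Step 2: split at `D`
  set D : ℕ := ⌈(N : ℝ) ^ (4 / 5 : ℝ)⌉₊ with hD
  set f : ℕ → ℝ := fun d ↦ ∑ p ∈ gcdPairs N d, ‖Rfun W ((p.1 : ℝ) / p.2)‖ ^ 3 with hf
  have hf0 : ∀ d, 0 ≤ f d := fun d ↦ by positivity
  have hsplit : S₃ ≤ ∑ d ∈ Finset.Icc 1 D, f d + ∑ d ∈ Finset.Ioc D (2 * N), f d := by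
    have e : S₃ = ∑ d ∈ Finset.Icc 1 (2 * N), f d :=
      sum_sq_eq_sum_gcd hN1 (fun n₁ n₂ ↦ ‖Rfun W ((n₁ : ℝ) / n₂)‖ ^ 3)
    have hsub : Finset.Icc 1 (2 * N) ⊆ Finset.Icc 1 D ∪ Finset.Ioc D (2 * N) := by
      intro d hd
      rw [Finset.mem_Icc] at hd
      rw [Finset.mem_union, Finset.mem_Icc, Finset.mem_Ioc]
      omega
    have hdisj : Disjoint (Finset.Icc 1 D) (Finset.Ioc D (2 * N)) := by
      rw [Finset.disjoint_left]
      intro d hd hd'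
      rw [Finset.mem_Icc] at hd
      rw [Finset.mem_Ioc] at hd'
      omega
    rw [e]
    calc ∑ d ∈ Finset.Icc 1 (2 * N), f d ≤ ∑ d ∈ Finset.Icc 1 D ∪ Finset.Ioc D (2 * N), f d :=
          Finset.sum_le_sum_of_subset_of_nonneg hsub fun d _ _ ↦ hf0 d
      _ = _ := Finset.sum_union hdisj
  -- Step 3: the two parts
  have hS := hCs N hN1 t₀ W hW hsep hWpos'
  have hL := hCg N hN1 t₀ W hW hsep hWpos'
  set P : ℝ := (N : ℝ) ^ 2 * K ^ (1 / 2 : ℝ) * E₁ ^ (1 / 2 : ℝ) with hP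
  set Q : ℝ := (N : ℝ) * K ^ 3 with hQ
  set U : ℝ := K ^ (21 / 8 : ℝ) * (N : ℝ) ^ (13 / 10 : ℝ) with hU
  change ∑ d ∈ Finset.Icc 1 D, f d ≤ Cs * (N : ℝ) ^ η * P + Cs * Q at hS
  change ∑ d ∈ Finset.Ioc D (2 * N), f d ≤ Cg * (N : ℝ) ^ (3 * η) * (5 * Q + 2 * U + 4 * P) at hL
  have hP0 : 0 ≤ P := by positivity
  have hQ0 : 0 ≤ Q := by positivity
  have hU0 : 0 ≤ U := by positivity
  have hn3η1 : 1 ≤ (N : ℝ) ^ (3 * η) := Real.one_le_rpow hn1 (by positivity)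
  have hnη3η : (N : ℝ) ^ η ≤ (N : ℝ) ^ (3 * η) := Real.rpow_le_rpow_of_exponent_le hn1 (by linarith)
  have hS₃le : S₃ ≤ C₆ * (N : ℝ) ^ (3 * η) * (P + Q + U) := by
    have h2 : Cs * (N : ℝ) ^ η * P ≤ Cs * (N : ℝ) ^ (3 * η) * P := by gcongr
    have h3 : Cs * Q ≤ Cs * (N : ℝ) ^ (3 * η) * Q := by
      have : Cs * Q * 1 ≤ Cs * Q * (N : ℝ) ^ (3 * η) := mul_le_mul_of_nonneg_left hn3η1 (by positivity)
      linarith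
    have h4 : Cg * (N : ℝ) ^ (3 * η) * (5 * Q + 2 * U + 4 * P) ≤ 5 * Cg * (N : ℝ) ^ (3 * η) * (P + Q + U) := by
      have : 0 ≤ Cg * (N : ℝ) ^ (3 * η) := by positivity
      nlinarith
    have h5 : Cs * (N : ℝ) ^ (3 * η) * P + Cs * (N : ℝ) ^ (3 * η) * Q ≤ Cs * (N : ℝ) ^ (3 * η) * (P + Q + U) := by
      have : 0 ≤ Cs * (N : ℝ) ^ (3 * η) := by positivity
      nlinarith
    calc S₃ ≤ Cs * (N : ℝ) ^ η * P + Cs * Q + Cg * (N : ℝ) ^ (3 * η) * (5 * Q + 2 * U + 4 * P) := by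
          linarith
      _ ≤ Cs * (N : ℝ) ^ (3 * η) * (P + Q + U) + 5 * Cg * (N : ℝ) ^ (3 * η) * (P + Q + U) := by linarith
      _ = C₆ * (N : ℝ) ^ (3 * η) * (P + Q + U) := by rw [hC₆]; ring
  -- Step 4: rearrange
  exact final_algebra hn1 hK0 hE₁0 hC₀0 hC₆0 hη0.le hηδ h114 hS₃le

/-! ## §5. `zeroDensity_guth_maynard` from Proposition 10.1 alone -/

/-- **`zeroDensity_guth_maynard` from Proposition 10.1 of Guth–Maynard alone.** With Proposition 6.1
(`GuthMaynardS2.S2_bound`, `LargeValuesS2Bound.lean`) and Proposition 11.1 (`energy_bound`) proved,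
the named fact `Literature.NumberTheory.LFunctions.zeroDensity_guth_maynard` (Guth–Maynard,
Theorem 1.2: `N(σ,T) ≪ T^{15(1−σ)/(3+5σ)+ε}`, `σ ≥ 7/10`) follows from the one remaining analytic
input of the proof of Proposition 3.1, the refined `S₃` bound of Proposition 10.1 (§§7–10 of the
paper) in the setting `T = N^{6/5}`, `W` `T^ε`-separated (`hS3`).
[cite: GuthMaynard2026, Theorem 1.2, Propositions 3.1, 10.1, 11.1, Section 12] -/
theorem zeroDensity_guth_maynard_of_S3
    (hS3 : ∀ w : ℝ → ℝ, ContDiff ℝ ∞ w → Function.support w ⊆ Set.Icc 1 2 →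
      (∀ u : ℝ, 6 / 5 ≤ u → u ≤ 9 / 5 → w u = 1) → (∀ u, 0 ≤ w u ∧ w u ≤ 1) →
      ∀ ε : ℝ, 0 < ε → ∀ δ : ℝ, 0 < δ → ∃ C N₀ : ℝ, ∀ N : ℕ, N₀ ≤ (N : ℝ) →
      ∀ (t₀ : ℝ) (W : Finset ℝ), (∀ t ∈ W, t₀ ≤ t ∧ t ≤ t₀ + (N : ℝ) ^ (6 / 5 : ℝ)) →
      (∀ t ∈ W, ∀ t' ∈ W, t ≠ t' → ((N : ℝ) ^ (6 / 5 : ℝ)) ^ ε ≤ |t - t'|) →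
      ‖GuthMaynardFourier.S3 w N W‖ ≤ C * (N : ℝ) ^ δ * (((N : ℝ) ^ (6 / 5 : ℝ)) ^ 2 * (W.card : ℝ) ^ (3 / 2 : ℝ) +
        (N : ℝ) ^ (6 / 5 : ℝ) * N * (W.card : ℝ) ^ (1 / 2 : ℝ) * (GuthMaynardAssembly.addEnergy W) ^ (1 / 2 : ℝ))) :
    zeroDensity_guth_maynard :=
  GuthMaynardS2.zeroDensity_guth_maynard_of_S3_of_energy hS3 energy_bound

end GuthMaynardEnergyBound

end Literature.NumberTheory.LFunctions

end
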